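import Literature.Analysis.FluidPDE.EulerFourierGalerkinCauchy
import Literature.Analysis.FluidPDE.TaoH1FourierMild
import HarnessLib

/-!
# The inviscid Galerkin limit: local Sobolev-mild solutions of the Euler equations on `ℝ³`
# (Majda–Bertozzi 2002, Thm. 3.4, proof pp. 108–111, on the Fourier side)

Fifth file of the Fourier–Galerkin construction of local smooth solutions of the Euler equations
on `ℝ³` with `H³`-controlled lifespan (discharge of
`Literature.Analysis.FluidPDE.MajdaBertozzi2002_localExistenceH3`, `NSVorticityBKM.lean`;
A. J. Majda, A. L. Bertozzi, *Vorticity and Incompressible Flow*, CUP 2002, §3.2.4). With the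
global regularised solutions (`EulerFourierGalerkin`), their `H^m` bounds uniform in the
regularisation on the `H³` lifespan `[0, τ(A)]` (`EulerFourierGalerkinEnergy`) and the Cauchy
estimate in `C([0, τ]; L²)` (`EulerFourierGalerkinCauchy`), Majda–Bertozzi (proof of Thm. 3.4,
pp. 108–111) let the regularisation go: the limit `v = lim v^ε` exists in `C([0,T]; L²)` ((3.64)),
inherits the uniform `H^m` bounds ((3.66)), and solves the equation (they pass to the limit in the
integrated equation (3.65)). This file carries this out on the Fourier side for `ν = 0` (for
`ν > 0` the target fact allows a `ν`-dependent lifespan and the tree's proved Picard theorem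
`tao2011_sobolevMild_exists_holds` is used instead, see `MajdaBertozzi2002_localExistenceH3_holds`):

* `datumLp`, `datumSym` — a Sobolev Fourier datum `a` (`IsSobolevFourierDatum a`) as an element of
  the phase space `symSubspace ⊂ 𝓗 = L²(ℝ³; ℂ³)`; `galerkinSeq` — the inviscid Galerkin solutions
  with radii `n + 1`; `galerkinLimit` — **the limit** `V(t) = lim_n α_n(clamp τ t)` in `𝓗`
  ((3.64): `norm_galerkinSeq_sub_galerkinLimit_le`, rate `D(A)/(n+2)`), in the phase space
  (`galerkinLimit_mem`), continuous in time (`continuous_galerkinLimit`, uniform limit);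
* `lintegral_weight_galerkinLimit_sq_le` — **the limit keeps the uniform `H^m` bounds** ((3.66)):
  `∫⁻ ((1+‖ξ‖)^m ‖V(t)‖)² ≤ B_m(A)` (`momentBound`), by continuity of the truncated energies,
  monotone convergence in the cut-off and `truncEnergy_le_mul_exp`;
* `limitCoeff`, `limitNonlin` — the coefficient field `Ṽ(s)` of the limit and `N(Ṽ(s), Ṽ(s))`,
  jointly continuous in `(s, ξ)` (`continuous_limitNonlin`, `continuous_fconv_family`) with
  pointwise decay of every order (`exists_norm_limitNonlin_le`);
* `inner_galerkinSeq_eq` — the weak (integrated) Galerkin equations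
  `⟪φ, α_n(t)⟫ = ⟪φ, a⟫ − ∫₀ᵗ ⟪φ, B_{n+1}(α_n, α_n)⟫` (FTC in `𝓗`), and
  `setIntegral_limitCoeff_eq` — **their limit** ((3.65)) against the test elements `1_S e_l`
  (`testLp`): `∫_S Ṽ(t)_l = ∫_S a_l − ∫₀ᵗ∫_S N(Ṽ,Ṽ)_l`, by dominated convergence, the nonlinear
  pairings converging because `‖χ_{n+1}α_n(s) − Ṽ(s)‖₂ ≤ δ_n → 0`
  (`lintegral_enorm_truncCoeff_galerkinSeq_sub_limitCoeff_le`, `approxRate`) and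
  `|N(p,q)(ξ)| ≤ C_N ‖ξ‖ ‖p‖₂ ‖q‖₂` (`enorm_nonlin_le_mul_rpow`);
* `eulerMild` — **the Duhamel representative** `v(t,ξ) = a(ξ) − ∫₀^{clamp τ t} N(Ṽ(s),Ṽ(s))(ξ) ds`
  (for `ν = 0` the Duhamel formula is the integrated equation), equal to `Ṽ(t)` a.e. at every time
  of the lifespan (`eulerMild_ae_eq`: Fubini and `ae_eq_zero_of_forall_setIntegral_eq_of_sigmaFinite`
  on balls);
* `isSobolevMild_eulerMild`, `exists_isSobolevMild_euler` — **local existence of Fourier-side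
  Sobolev-mild solutions of the Euler equations** (`IsSobolevMild 0 (lifespan A) a v`) for every
  Sobolev Fourier datum with `∫⁻ (1+‖ξ‖)⁶ ∑_l |a_l|² ≤ A`, the lifespan `τ(A) > 0` depending on `A`
  only — Thm. 3.4 for `ν = 0` with the `H³`-controlled lifespan of (3.79)/Thm. 3.6 in the tree's
  mild-solution interface, whose synthesis theorems (`IsSobolevMild.isClassicalNSSolutionOn`,
  `IsSobolevMild.hasBoundedSobolevNormsOn_u`, valid for `ν ≥ 0`) then give classical solutions.

No facts are introduced. Definitions: the datum packaging, the Galerkin sequence and limit, the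
moment bound, the representative fields, the test elements, the pairings, the rate `δ_n` and the
Duhamel representative — all with bodies.

## Mathlib / tree search

Tree: `IsSobolevMild`, `IsSobolevFourierDatum`, `duhamel`/`heat`/`clamp` (`TaoH1FourierMild`,
`NSFourierPicard`), `FujitaKato.enorm_nonlin_le`, `FujitaKato.lconv_eq_lconvolution`,
`FujitaKato.nonlin_conj_symm_ae` (`FujitaKatoPicard`/`Majorant`), `sum_mul_nonlin`,
`continuous_fconv_family`, `lconv_le_sqrt_mul_sqrt`, `sq_lintegral_le_weight`
(`FourierL2Convolution`), the `EulerFourierGalerkin*` API. Mathlib: `limUnder`/`tendsto_nhds_limUnder`,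
`cauchySeq_tendsto_of_complete`, `TendstoUniformlyOn.continuousOn`, `lintegral_iSup'`,
`intervalIntegral.integral_eq_sub_of_hasDeriv_right_of_le`,
`intervalIntegral.tendsto_integral_filter_of_dominated_convergence`, `intervalIntegral_integral_swap`,
`ae_eq_zero_of_forall_setIntegral_eq_of_sigmaFinite`, `ae_restrict_iUnion_iff`,
`intervalIntegral.continuous_parametric_intervalIntegral_of_continuous'`,
`intervalIntegral.continuous_primitive`, `ContinuousLinearMap.intervalIntegral_comp_comm`,
`integral_conj`.

## References

* A. J. Majda, A. L. Bertozzi, *Vorticity and Incompressible Flow*, CUP 2002: Thm. 3.4 (p. 104) and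
  its proof, (3.64)–(3.66) (pp. 108–111), (3.79) and the remark p. 117. [MajdaBertozzi2002]
-/

noncomputable section

open MeasureTheory Real Set Filter Function Metric
open scoped ENNReal NNReal ComplexConjugate InnerProductSpace Convolution
open _root_.Topology

namespace Literature.Analysis.FluidPDE.FourierNS

/-- Physical/frequency space `ℝ³`. -/
local notation "ℝ³" => EuclideanSpace ℝ (Fin 3)
/-- The fibre `ℂ³` of the coefficient fields. -/
local notation "ℂ³" => EuclideanSpace ℂ (Fin 3)
/-- The Hilbert space `L²(ℝ³; ℂ³)` of Fourier coefficient fields. -/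
local notation "𝓗" => Lp (EuclideanSpace ℂ (Fin 3)) 2 (volume : Measure (EuclideanSpace ℝ (Fin 3)))

/-! ### The datum as an element of the phase space -/

section Datum

variable {a : ℝ³ → Fin 3 → ℂ}

/-- The `ℂ³`-valued version of a coefficient field `a : ℝ³ → (Fin 3 → ℂ)`. [folklore] -/
def datumE (a : ℝ³ → Fin 3 → ℂ) : ℝ³ → ℂ³ := fun ξ => (EuclideanSpace.equiv (Fin 3) ℂ).symm (a ξ)

/-- Components of `datumE`. [folklore] -/
@[simp] theorem datumE_apply (a : ℝ³ → Fin 3 → ℂ) (ξ : ℝ³) (l : Fin 3) : datumE a ξ l = a ξ l := rfl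

/-- `‖datumE a ξ‖ₑ² = ∑_l ‖a ξ l‖ₑ²`. [folklore] -/
theorem enorm_datumE_sq (a : ℝ³ → Fin 3 → ℂ) (ξ : ℝ³) : ‖datumE a ξ‖ₑ ^ 2 = ∑ l, ‖a ξ l‖ₑ ^ 2 := by
  rw [← ofReal_norm, ← ENNReal.ofReal_pow (norm_nonneg _), EuclideanSpace.norm_sq_eq,
    ENNReal.ofReal_sum_of_nonneg (fun l _ => by positivity)]
  refine Finset.sum_congr rfl fun l _ => ?_
  rw [← ofReal_norm, ← ENNReal.ofReal_pow (norm_nonneg _)]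
  rfl

/-- For any `v : 𝓗`, `‖v ξ‖ₑ² = ∑_l ‖coeff v ξ l‖ₑ²`. [folklore] -/
theorem enorm_fibre_sq (v : 𝓗) (ξ : ℝ³) : ‖(v : ℝ³ → ℂ³) ξ‖ₑ ^ 2 = ∑ l, ‖coeff v ξ l‖ₑ ^ 2 := by
  rw [← ofReal_norm, ← ENNReal.ofReal_pow (norm_nonneg _), norm_fibre_sq_eq,
    ENNReal.ofReal_sum_of_nonneg (fun l _ => by positivity)]
  refine Finset.sum_congr rfl fun l _ => ?_
  rw [← ofReal_norm, ← ENNReal.ofReal_pow (norm_nonneg _)]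

/-- `(w x)² = w² x²`-bookkeeping: `(ofReal((1+‖ξ‖)^m) y)² = ofReal((1+‖ξ‖)^{2m}) y²`. [folklore] -/
theorem weight_mul_sq (m : ℕ) (ξ : ℝ³) (y : ℝ≥0∞) :
    (ENNReal.ofReal ((1 + ‖ξ‖) ^ m) * y) ^ 2 = ENNReal.ofReal ((1 + ‖ξ‖) ^ (2 * m)) * y ^ 2 := by
  rw [mul_pow, ← ENNReal.ofReal_pow (by positivity), ← pow_mul, mul_comm m 2]

/-- A Sobolev Fourier datum is square integrable as a `ℂ³`-valued field. [folklore] -/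
theorem memLp_datumE (ha : IsSobolevFourierDatum a) : MemLp (datumE a) 2 volume := by
  have hm : AEStronglyMeasurable (datumE a) volume :=
    (EuclideanSpace.equiv (Fin 3) ℂ).symm.continuous.comp_aestronglyMeasurable ha.meas
  refine ⟨hm, ?_⟩
  rw [← lintegral_enorm_sq_rpow_half_eq_eLpNorm]
  refine ENNReal.rpow_lt_top_of_nonneg (by norm_num) (lt_top_iff_ne_top.1 ?_)
  have h := ha.lintegral_sum_enorm_sq_lt_top
  calc ∫⁻ ξ, ‖datumE a ξ‖ₑ ^ 2 = ∫⁻ ξ, ∑ l, ‖a ξ l‖ₑ ^ 2 := lintegral_congr fun ξ => enorm_datumE_sq a ξ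
    _ < ⊤ := h

/-- The datum as an element of `𝓗 = L²(ℝ³; ℂ³)`. [folklore] -/
def datumLp (ha : IsSobolevFourierDatum a) : 𝓗 := (memLp_datumE ha).toLp _

/-- The coefficients of `datumLp` are the datum, a.e. [folklore] -/
theorem coeff_datumLp_ae (ha : IsSobolevFourierDatum a) :
    ∀ᵐ ξ ∂(volume : Measure ℝ³), ∀ l, coeff (datumLp ha) ξ l = a ξ l := by
  filter_upwards [MemLp.coeFn_toLp (memLp_datumE ha)] with ξ hξ
  intro l
  rw [coeff_apply, datumLp, hξ, datumE_apply]

/-- The fibres of `datumLp` are the datum, a.e. [folklore] -/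
theorem datumLp_ae (ha : IsSobolevFourierDatum a) :
    ∀ᵐ ξ ∂(volume : Measure ℝ³), ((datumLp ha : 𝓗) : ℝ³ → ℂ³) ξ = datumE a ξ :=
  MemLp.coeFn_toLp (memLp_datumE ha)

/-- The datum lies in the phase space `symSubspace`. [folklore] -/
theorem datumLp_mem (ha : IsSobolevFourierDatum a) : datumLp ha ∈ symSubspace := by
  rw [mem_symSubspace_iff]
  constructor
  · filter_upwards [coeff_datumLp_ae ha] with ξ hξ
    simp only [hξ, ha.divFree ξ]
  · filter_upwards [coeff_datumLp_ae ha, ae_neg (coeff_datumLp_ae ha)] with ξ h1 h2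
    intro l
    rw [h1 l, h2 l, ha.conjSymm ξ l]

/-- **Weighted moments of the datum in `𝓗`-form**:
`∫⁻ ((1+‖ξ‖)^m ‖a(ξ)‖)² = ∫⁻ (1+‖ξ‖)^{2m} ∑_l |a_l(ξ)|²`. [folklore] -/
theorem lintegral_weight_datumLp_sq (ha : IsSobolevFourierDatum a) (m : ℕ) :
    ∫⁻ ξ, (ENNReal.ofReal ((1 + ‖ξ‖) ^ m) * ‖((datumLp ha : 𝓗) : ℝ³ → ℂ³) ξ‖ₑ) ^ 2 =
      ∫⁻ ξ, ENNReal.ofReal ((1 + ‖ξ‖) ^ (2 * m)) * ∑ l, ‖a ξ l‖ₑ ^ 2 := by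
  refine lintegral_congr_ae ((datumLp_ae ha).mono fun ξ hξ => ?_)
  show (ENNReal.ofReal ((1 + ‖ξ‖) ^ m) * ‖((datumLp ha : 𝓗) : ℝ³ → ℂ³) ξ‖ₑ) ^ 2 = _
  rw [weight_mul_sq, hξ, enorm_datumE_sq]

/-- The datum as an element of the phase space. [folklore] -/
def datumSym (ha : IsSobolevFourierDatum a) : symSubspace := ⟨datumLp ha, datumLp_mem ha⟩

/-- Coercion of `datumSym`. [folklore] -/
@[simp] theorem coe_datumSym (ha : IsSobolevFourierDatum a) : (datumSym ha : 𝓗) = datumLp ha := rfl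

end Datum

/-! ### The Galerkin sequence and its limit -/

section Limit

variable {a : ℝ³ → Fin 3 → ℂ} {A : ℝ}

/-- `D/(n+2) → 0`. [folklore] -/
theorem tendsto_const_div_add_two (D : ℝ) : Tendsto (fun n : ℕ => D / ((n : ℝ) + 2)) atTop (𝓝 0) := by
  have h1 : Tendsto (fun n : ℕ => 1 / (((n + 1 : ℕ) : ℝ) + 1)) atTop (𝓝 0) :=
    (tendsto_add_atTop_iff_nat 1).2 (tendsto_one_div_add_atTop_nhds_zero_nat (𝕜 := ℝ))
  have h2 : Tendsto (fun n : ℕ => D * (1 / (((n + 1 : ℕ) : ℝ) + 1))) atTop (𝓝 (D * 0)) := h1.const_mul D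
  rw [mul_zero] at h2
  refine h2.congr fun n => ?_
  push_cast
  ring

/-- The inviscid Galerkin solution with cut-off radius `n + 1` issued from the datum (a choice of
the global solution of `exists_galerkin_solution`). [cite: MajdaBertozzi2002, Thm. 3.2 (3.51) p. 100] -/
def galerkinSeq (ha : IsSobolevFourierDatum a) (n : ℕ) : ℝ → symSubspace :=
  Classical.choose (exists_galerkin_solution le_rfl ((n : ℝ) + 1) (datumSym ha))

/-- The Galerkin sequence starts at the datum. [folklore] -/
theorem galerkinSeq_zero (ha : IsSobolevFourierDatum a) (n : ℕ) : galerkinSeq ha n 0 = datumSym ha :=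
  (Classical.choose_spec (exists_galerkin_solution le_rfl ((n : ℝ) + 1) (datumSym ha))).1

/-- The Galerkin sequence solves the inviscid Galerkin system on every `[0, T]`. [folklore] -/
theorem galerkinSeq_hasDerivWithinAt (ha : IsSobolevFourierDatum a) (n : ℕ) (T : ℝ) :
    ∀ t ∈ Icc 0 T, HasDerivWithinAt (galerkinSeq ha n) (galerkinField 0 ((n : ℝ) + 1) (galerkinSeq ha n t))
      (Icc 0 T) t :=
  (Classical.choose_spec (exists_galerkin_solution le_rfl ((n : ℝ) + 1) (datumSym ha))).2 T

/-- The `H³` moment hypothesis on the datum in `𝓗`-form. [folklore] -/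
theorem lintegral_weight_three_datumLp_le (ha : IsSobolevFourierDatum a)
    (hM : ∫⁻ ξ, ENNReal.ofReal ((1 + ‖ξ‖) ^ 6) * ∑ l, ‖a ξ l‖ₑ ^ 2 ≤ ENNReal.ofReal A) :
    ∫⁻ ξ, (ENNReal.ofReal ((1 + ‖ξ‖) ^ 3) * ‖((datumLp ha : 𝓗) : ℝ³ → ℂ³) ξ‖ₑ) ^ 2 ≤ ENNReal.ofReal A := by
  rw [lintegral_weight_datumLp_sq ha 3]
  exact hM

/-- **The Cauchy estimate along the Galerkin sequence**: for `n ≤ n'` and `0 ≤ t ≤ τ(A)`,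
`‖α_n(t) − α_{n'}(t)‖ ≤ D(A)/(n+2)`. [cite: MajdaBertozzi2002, Lemma 3.7 (3.61) p. 107] -/
theorem norm_galerkinSeq_sub_le (ha : IsSobolevFourierDatum a) (hA : 0 ≤ A)
    (hM : ∫⁻ ξ, ENNReal.ofReal ((1 + ‖ξ‖) ^ 6) * ∑ l, ‖a ξ l‖ₑ ^ 2 ≤ ENNReal.ofReal A)
    {n n' : ℕ} (hnn' : n ≤ n') {t : ℝ} (ht : t ∈ Icc 0 (lifespan A)) :
    ‖(galerkinSeq ha n t : 𝓗) - (galerkinSeq ha n' t : 𝓗)‖ ≤ cauchyConst A / ((n : ℝ) + 2) := by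
  have h := norm_sub_le_of_galerkin_solutions hA (by positivity : (0 : ℝ) ≤ (n : ℝ) + 1)
    (by exact_mod_cast Nat.add_le_add_right hnn' 1 : (n : ℝ) + 1 ≤ (n' : ℝ) + 1) le_rfl
    (a := datumSym ha) (lintegral_weight_three_datumLp_le ha hM)
    (galerkinSeq_hasDerivWithinAt ha n (lifespan A)) (galerkinSeq_zero ha n)
    (galerkinSeq_hasDerivWithinAt ha n' (lifespan A)) (galerkinSeq_zero ha n') t ht
  refine h.trans (le_of_eq ?_)
  congr 1
  ring

/-- The Galerkin sequence is Cauchy at every time of the lifespan. [folklore] -/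
theorem cauchySeq_galerkinSeq (ha : IsSobolevFourierDatum a) (hA : 0 ≤ A)
    (hM : ∫⁻ ξ, ENNReal.ofReal ((1 + ‖ξ‖) ^ 6) * ∑ l, ‖a ξ l‖ₑ ^ 2 ≤ ENNReal.ofReal A)
    {t : ℝ} (ht : t ∈ Icc 0 (lifespan A)) : CauchySeq fun n => (galerkinSeq ha n t : 𝓗) := by
  refine cauchySeq_of_le_tendsto_0 (fun N => cauchyConst A / ((N : ℝ) + 2)) (fun n m N hn hm => ?_) ?_
  · rw [dist_eq_norm]
    rcases le_total n m with h | h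
    · exact (norm_galerkinSeq_sub_le ha hA hM h ht).trans
        (div_le_div_of_nonneg_left (cauchyConst_nonneg hA) (by positivity) (by exact_mod_cast (by omega : N + 2 ≤ n + 2)))
    · rw [norm_sub_rev]
      exact (norm_galerkinSeq_sub_le ha hA hM h ht).trans
        (div_le_div_of_nonneg_left (cauchyConst_nonneg hA) (by positivity) (by exact_mod_cast (by omega : N + 2 ≤ m + 2)))
  · exact tendsto_const_div_add_two (cauchyConst A)

/-- **The Galerkin limit** `V(t) = lim_n α_n(clamp τ t)` in `𝓗` (time clamped to the lifespan
`[0, τ(A)]`). [cite: MajdaBertozzi2002, Thm. 3.4 proof, (3.64) p. 109] -/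
def galerkinLimit (ha : IsSobolevFourierDatum a) (A : ℝ) (t : ℝ) : 𝓗 :=
  limUnder atTop fun n => (galerkinSeq ha n (clamp (lifespan A) t) : 𝓗)

/-- The Galerkin sequence converges to the Galerkin limit at clamped times. [folklore] -/
theorem tendsto_galerkinSeq (ha : IsSobolevFourierDatum a) (hA : 0 ≤ A)
    (hM : ∫⁻ ξ, ENNReal.ofReal ((1 + ‖ξ‖) ^ 6) * ∑ l, ‖a ξ l‖ₑ ^ 2 ≤ ENNReal.ofReal A) (t : ℝ) :
    Tendsto (fun n => (galerkinSeq ha n (clamp (lifespan A) t) : 𝓗)) atTop (𝓝 (galerkinLimit ha A t)) :=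
  tendsto_nhds_limUnder (cauchySeq_tendsto_of_complete (cauchySeq_galerkinSeq ha hA hM
    ⟨clamp_nonneg _ _, clamp_le (lifespan_pos hA).le _⟩))

/-- **Rate of convergence**: `‖α_n(clamp τ t) − V(t)‖ ≤ D(A)/(n+2)`. [folklore] -/
theorem norm_galerkinSeq_sub_galerkinLimit_le (ha : IsSobolevFourierDatum a) (hA : 0 ≤ A)
    (hM : ∫⁻ ξ, ENNReal.ofReal ((1 + ‖ξ‖) ^ 6) * ∑ l, ‖a ξ l‖ₑ ^ 2 ≤ ENNReal.ofReal A) (n : ℕ) (t : ℝ) :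
    ‖(galerkinSeq ha n (clamp (lifespan A) t) : 𝓗) - galerkinLimit ha A t‖ ≤ cauchyConst A / ((n : ℝ) + 2) := by
  have ht : clamp (lifespan A) t ∈ Icc 0 (lifespan A) := ⟨clamp_nonneg _ _, clamp_le (lifespan_pos hA).le _⟩
  have hlim := (tendsto_const_nhds (x := (galerkinSeq ha n (clamp (lifespan A) t) : 𝓗))).sub
    (tendsto_galerkinSeq ha hA hM t)
  refine le_of_tendsto hlim.norm (eventually_atTop.2 ⟨n, fun m hm => ?_⟩)
  exact norm_galerkinSeq_sub_le ha hA hM hm ht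

/-- The Galerkin limit lies in the phase space. [folklore] -/
theorem galerkinLimit_mem (ha : IsSobolevFourierDatum a) (hA : 0 ≤ A)
    (hM : ∫⁻ ξ, ENNReal.ofReal ((1 + ‖ξ‖) ^ 6) * ∑ l, ‖a ξ l‖ₑ ^ 2 ≤ ENNReal.ofReal A) (t : ℝ) :
    galerkinLimit ha A t ∈ symSubspace :=
  isClosed_symSubspace.mem_of_tendsto (tendsto_galerkinSeq ha hA hM t)
    (Eventually.of_forall fun n => (galerkinSeq ha n _).2)

/-- The Galerkin limit only sees clamped time. [folklore] -/
theorem galerkinLimit_clamp (ha : IsSobolevFourierDatum a) (hA : 0 ≤ A) (t : ℝ) :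
    galerkinLimit ha A (clamp (lifespan A) t) = galerkinLimit ha A t := by
  simp only [galerkinLimit, clamp_clamp (lifespan_pos hA).le]

/-- The Galerkin limit starts at the datum. [folklore] -/
theorem galerkinLimit_zero (ha : IsSobolevFourierDatum a) (hA : 0 ≤ A)
    (hM : ∫⁻ ξ, ENNReal.ofReal ((1 + ‖ξ‖) ^ 6) * ∑ l, ‖a ξ l‖ₑ ^ 2 ≤ ENNReal.ofReal A) :
    galerkinLimit ha A 0 = datumLp ha := by
  have h := tendsto_galerkinSeq ha hA hM 0
  simp only [clamp_zero (lifespan_pos hA).le, galerkinSeq_zero, coe_datumSym] at h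
  exact tendsto_nhds_unique h tendsto_const_nhds

/-- **Continuity of the Galerkin limit in time** (uniform limit of continuous trajectories, then
composed with the clamp). [folklore] -/
theorem continuous_galerkinLimit (ha : IsSobolevFourierDatum a) (hA : 0 ≤ A)
    (hM : ∫⁻ ξ, ENNReal.ofReal ((1 + ‖ξ‖) ^ 6) * ∑ l, ‖a ξ l‖ₑ ^ 2 ≤ ENNReal.ofReal A) :
    Continuous (galerkinLimit ha A) := by
  set τ := lifespan A with hτ
  have hτ0 : 0 < τ := lifespan_pos hA
  -- uniform convergence on `[0, τ]`
  have hunif : TendstoUniformlyOn (fun n t => (galerkinSeq ha n t : 𝓗)) (galerkinLimit ha A) atTop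
      (Icc 0 τ) := by
    rw [Metric.tendstoUniformlyOn_iff]
    intro ε hε
    have h1 := tendsto_const_div_add_two (cauchyConst A)
    filter_upwards [(tendsto_order.1 h1).2 ε hε] with n hn t ht
    rw [dist_comm, dist_eq_norm]
    have h3 := norm_galerkinSeq_sub_galerkinLimit_le ha hA hM n t
    rw [clamp_of_mem ht] at h3
    exact h3.trans_lt hn
  have hcn : ∀ n, ContinuousOn (fun t => (galerkinSeq ha n t : 𝓗)) (Icc 0 τ) := fun n t ht =>
    (hasDerivWithinAt_coe_of_galerkinField (galerkinSeq_hasDerivWithinAt ha n τ t ht)).continuousWithinAt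
  have hcont : ContinuousOn (galerkinLimit ha A) (Icc 0 τ) :=
    hunif.continuousOn (Eventually.of_forall hcn).frequently
  have hcomp : galerkinLimit ha A = galerkinLimit ha A ∘ clamp τ := by
    funext t; exact (galerkinLimit_clamp ha hA t).symm
  rw [hcomp]
  exact hcont.comp_continuous (continuous_clamp τ) fun t => ⟨clamp_nonneg _ _, clamp_le hτ0.le _⟩

end Limit

/-! ### Weighted moments of the Galerkin limit -/

section Moments

variable {a : ℝ³ → Fin 3 → ℂ} {A : ℝ}

/-- The truncated energy is monotone in the cut-off radius. [folklore] -/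
theorem truncEnergy_mono_radius (m : ℕ) {ρ ρ' : ℝ} (h : ρ ≤ ρ') (v : 𝓗) :
    truncEnergy m ρ v ≤ truncEnergy m ρ' v := by
  rw [truncEnergy_eq_integral, truncEnergy_eq_integral]
  refine integral_mono (integrable_symbol_mul_norm_sq (measurable_energySymbol m ρ) (abs_energySymbol_le m ρ) v)
    (integrable_symbol_mul_norm_sq (measurable_energySymbol m ρ') (abs_energySymbol_le m ρ') v) fun ξ => ?_
  refine mul_le_mul_of_nonneg_right ?_ (sq_nonneg _)
  rw [energySymbol_apply, energySymbol_apply]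
  refine mul_le_mul_of_nonneg_left ?_ (sq_nonneg _)
  unfold cutoff
  split_ifs with h1 h2 <;> first | rfl | linarith

/-- The truncated energy is a continuous function on `𝓗`. [folklore] -/
theorem continuous_truncEnergy (m : ℕ) (ρ : ℝ) : Continuous fun v : 𝓗 => truncEnergy m ρ v := by
  unfold truncEnergy
  exact Complex.continuous_re.comp (continuous_id.inner (energyCLM m ρ).continuous)

/-- The truncated energy as a cut-off weighted `L²` integral of the fibre norm:
`E_m^ρ(v) = ∫⁻ χ_ρ ((1+‖ξ‖)^m ‖v(ξ)‖)²`. [folklore] -/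
theorem ofReal_truncEnergy_eq_lintegral_cutoff (m : ℕ) (ρ : ℝ) (v : 𝓗) :
    ENNReal.ofReal (truncEnergy m ρ v) =
      ∫⁻ ξ, ENNReal.ofReal (cutoff ρ ξ) * (ENNReal.ofReal ((1 + ‖ξ‖) ^ m) * ‖(v : ℝ³ → ℂ³) ξ‖ₑ) ^ 2 := by
  rw [ofReal_truncEnergy_eq_sum_lintegral]
  have hmeas : ∀ l : Fin 3, AEMeasurable (fun ξ => (ENNReal.ofReal ((1 + ‖ξ‖) ^ m) *
      ‖truncCoeff ρ v ξ l‖ₑ) ^ 2) volume := fun l =>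
    ((measurable_ofReal_weight m).aemeasurable.mul
      (aesm_apply (aestronglyMeasurable_truncCoeff ρ v) l).enorm).pow_const 2
  rw [← lintegral_finsetSum' _ fun l _ => hmeas l]
  refine lintegral_congr fun ξ => ?_
  have hc : ∀ l, ‖truncCoeff ρ v ξ l‖ₑ = ENNReal.ofReal (cutoff ρ ξ) * ‖coeff v ξ l‖ₑ := fun l => by
    rw [truncCoeff_apply, enorm_mul, ← ofReal_norm (((cutoff ρ ξ : ℝ)) : ℂ), Complex.norm_real,
      Real.norm_of_nonneg (cutoff_nonneg ρ ξ)]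
  simp_rw [hc]
  rw [mul_pow, enorm_fibre_sq, Finset.mul_sum, Finset.mul_sum]
  refine Finset.sum_congr rfl fun l _ => ?_
  have h2 : ENNReal.ofReal (cutoff ρ ξ) ^ 2 = ENNReal.ofReal (cutoff ρ ξ) := by
    rw [sq, ← ENNReal.ofReal_mul (cutoff_nonneg ρ ξ), cutoff_mul_self]
  rw [mul_pow, mul_pow, h2]
  ring

/-- **Monotone convergence in the cut-off**: `∫⁻ ((1+‖ξ‖)^m ‖v(ξ)‖)² = sup_n E_m^n(v)`. [folklore] -/
theorem lintegral_weight_sq_eq_iSup_truncEnergy (m : ℕ) (v : 𝓗) :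
    ∫⁻ ξ, (ENNReal.ofReal ((1 + ‖ξ‖) ^ m) * ‖(v : ℝ³ → ℂ³) ξ‖ₑ) ^ 2 =
      ⨆ n : ℕ, ENNReal.ofReal (truncEnergy m n v) := by
  simp_rw [ofReal_truncEnergy_eq_lintegral_cutoff]
  have hF : AEMeasurable (fun ξ => (ENNReal.ofReal ((1 + ‖ξ‖) ^ m) * ‖(v : ℝ³ → ℂ³) ξ‖ₑ) ^ 2) volume :=
    ((measurable_ofReal_weight m).aemeasurable.mul (Lp.aestronglyMeasurable v).enorm).pow_const 2
  have hmono : Monotone fun (n : ℕ) (ξ : ℝ³) => ENNReal.ofReal (cutoff n ξ) *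
      (ENNReal.ofReal ((1 + ‖ξ‖) ^ m) * ‖(v : ℝ³ → ℂ³) ξ‖ₑ) ^ 2 := by
    intro n n' h ξ
    refine mul_le_mul_left (ENNReal.ofReal_le_ofReal ?_) _
    unfold cutoff
    have h' : (n : ℝ) ≤ n' := by exact_mod_cast h
    split_ifs with h1 h2 <;> first | rfl | linarith
  have hmeas : ∀ n : ℕ, AEMeasurable (fun ξ => ENNReal.ofReal (cutoff n ξ) *
      (ENNReal.ofReal ((1 + ‖ξ‖) ^ m) * ‖(v : ℝ³ → ℂ³) ξ‖ₑ) ^ 2) volume := fun n =>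
    (measurable_cutoff (n : ℝ)).ennreal_ofReal.aemeasurable.mul hF
  rw [← lintegral_iSup' hmeas (ae_of_all _ fun ξ n n' h => hmono h ξ)]
  refine lintegral_congr fun ξ => ?_
  refine le_antisymm ?_ (iSup_le fun n => ?_)
  · refine le_iSup_of_le ⌈‖ξ‖⌉₊ (le_of_eq ?_)
    rw [cutoff_of_le (Nat.le_ceil ‖ξ‖), ENNReal.ofReal_one, one_mul]
  · calc ENNReal.ofReal (cutoff n ξ) * (ENNReal.ofReal ((1 + ‖ξ‖) ^ m) * ‖(v : ℝ³ → ℂ³) ξ‖ₑ) ^ 2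
        ≤ 1 * (ENNReal.ofReal ((1 + ‖ξ‖) ^ m) * ‖(v : ℝ³ → ℂ³) ξ‖ₑ) ^ 2 := by
          gcongr
          rw [← ENNReal.ofReal_one]
          exact ENNReal.ofReal_le_ofReal (cutoff_le_one n ξ)
      _ = _ := one_mul _

/-- The bound of the weighted moments of order `m ≥ 1` of the Galerkin limit:
`B_m(A) = (∫⁻ ((1+‖ξ‖)^m‖a‖)²).toReal · exp(Λ'_m 2(A+1)^{1/2} τ(A))`. [folklore] -/
def momentBound (ha : IsSobolevFourierDatum a) (A : ℝ) (m : ℕ) : ℝ :=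
  (∫⁻ ξ, (ENNReal.ofReal ((1 + ‖ξ‖) ^ m) * ‖((datumLp ha : 𝓗) : ℝ³ → ℂ³) ξ‖ₑ) ^ 2).toReal *
    Real.exp (energyRate m * (2 * Real.sqrt (A + 1)) * lifespan A)

/-- `B_m(A) ≥ 0`. [folklore] -/
theorem momentBound_nonneg (ha : IsSobolevFourierDatum a) (A : ℝ) (m : ℕ) : 0 ≤ momentBound ha A m := by
  unfold momentBound; positivity

/-- The weighted moments of the datum are finite. [folklore] -/
theorem lintegral_weight_datumLp_sq_lt_top (ha : IsSobolevFourierDatum a) (m : ℕ) :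
    ∫⁻ ξ, (ENNReal.ofReal ((1 + ‖ξ‖) ^ m) * ‖((datumLp ha : 𝓗) : ℝ³ → ℂ³) ξ‖ₑ) ^ 2 < ⊤ := by
  rw [lintegral_weight_datumLp_sq]; exact ha.moments m

/-- **The truncated energies of the Galerkin limit are bounded by `B_m(A)`** (continuity of the
energy, monotonicity in the cut-off and the uniform bound `truncEnergy_le_mul_exp` along the
sequence). [cite: MajdaBertozzi2002, Thm. 3.4 proof, (3.60) and (3.66) pp. 106, 110] -/
theorem truncEnergy_galerkinLimit_le (ha : IsSobolevFourierDatum a) (hA : 0 ≤ A)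
    (hM : ∫⁻ ξ, ENNReal.ofReal ((1 + ‖ξ‖) ^ 6) * ∑ l, ‖a ξ l‖ₑ ^ 2 ≤ ENNReal.ofReal A)
    {m : ℕ} (hm : 1 ≤ m) (k : ℕ) (t : ℝ) :
    truncEnergy m k (galerkinLimit ha A t) ≤ momentBound ha A m := by
  set τ := lifespan A with hτ
  have hτ0 : 0 < τ := lifespan_pos hA
  set s := clamp τ t with hs
  have hsI : s ∈ Icc 0 τ := ⟨clamp_nonneg _ _, clamp_le hτ0.le _⟩
  have hlim := ((continuous_truncEnergy m k).tendsto _).comp (tendsto_galerkinSeq ha hA hM t)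
  refine le_of_tendsto hlim (eventually_atTop.2 ⟨k, fun n hn => ?_⟩)
  simp only [Function.comp_apply]
  have hkn : (k : ℝ) ≤ (n : ℝ) + 1 := by exact_mod_cast Nat.le_succ_of_le hn
  have h0 : truncEnergy 3 ((n : ℝ) + 1) (galerkinSeq ha n 0 : 𝓗) ≤ A := by
    rw [galerkinSeq_zero, coe_datumSym]
    exact truncEnergy_three_initial_le hA _ (lintegral_weight_three_datumLp_le ha hM)
  have h1 := truncEnergy_le_mul_exp le_rfl hm hA le_rfl (galerkinSeq_hasDerivWithinAt ha n τ) h0 s hsI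
  have hinit : truncEnergy m ((n : ℝ) + 1) (galerkinSeq ha n 0 : 𝓗) ≤
      (∫⁻ ξ, (ENNReal.ofReal ((1 + ‖ξ‖) ^ m) * ‖((datumLp ha : 𝓗) : ℝ³ → ℂ³) ξ‖ₑ) ^ 2).toReal := by
    rw [galerkinSeq_zero, coe_datumSym]
    exact (ENNReal.ofReal_le_iff_le_toReal (lintegral_weight_datumLp_sq_lt_top ha m).ne).1
      (ofReal_truncEnergy_le_lintegral m _ _)
  have hrate : 0 ≤ energyRate m * (2 * Real.sqrt (A + 1)) := by
    have := energyRate_pos m; positivity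
  calc truncEnergy m k (galerkinSeq ha n s : 𝓗) ≤ truncEnergy m ((n : ℝ) + 1) (galerkinSeq ha n s : 𝓗) :=
        truncEnergy_mono_radius m hkn _
    _ ≤ truncEnergy m ((n : ℝ) + 1) (galerkinSeq ha n 0 : 𝓗) *
          Real.exp (energyRate m * (2 * Real.sqrt (A + 1)) * s) := h1
    _ ≤ (∫⁻ ξ, (ENNReal.ofReal ((1 + ‖ξ‖) ^ m) * ‖((datumLp ha : 𝓗) : ℝ³ → ℂ³) ξ‖ₑ) ^ 2).toReal *
          Real.exp (energyRate m * (2 * Real.sqrt (A + 1)) * τ) := by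
        refine mul_le_mul hinit (Real.exp_le_exp.2 (mul_le_mul_of_nonneg_left hsI.2 hrate))
          (Real.exp_pos _).le ENNReal.toReal_nonneg
    _ = momentBound ha A m := rfl

/-- **Weighted moments of the Galerkin limit**: `∫⁻ ((1+‖ξ‖)^m ‖V(t)(ξ)‖)² ≤ B_m(A)` for `m ≥ 1`
(monotone convergence in the cut-off). [cite: MajdaBertozzi2002, Thm. 3.4 proof, (3.66) p. 110] -/
theorem lintegral_weight_galerkinLimit_sq_le (ha : IsSobolevFourierDatum a) (hA : 0 ≤ A)
    (hM : ∫⁻ ξ, ENNReal.ofReal ((1 + ‖ξ‖) ^ 6) * ∑ l, ‖a ξ l‖ₑ ^ 2 ≤ ENNReal.ofReal A)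
    {m : ℕ} (hm : 1 ≤ m) (t : ℝ) :
    ∫⁻ ξ, (ENNReal.ofReal ((1 + ‖ξ‖) ^ m) * ‖((galerkinLimit ha A t : 𝓗) : ℝ³ → ℂ³) ξ‖ₑ) ^ 2 ≤
      ENNReal.ofReal (momentBound ha A m) := by
  rw [lintegral_weight_sq_eq_iSup_truncEnergy]
  exact iSup_le fun k => ENNReal.ofReal_le_ofReal (truncEnergy_galerkinLimit_le ha hA hM hm k t)

/-- Moments of order `0` from those of order `1`. [folklore] -/
theorem lintegral_weight_zero_galerkinLimit_sq_le (ha : IsSobolevFourierDatum a) (hA : 0 ≤ A)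
    (hM : ∫⁻ ξ, ENNReal.ofReal ((1 + ‖ξ‖) ^ 6) * ∑ l, ‖a ξ l‖ₑ ^ 2 ≤ ENNReal.ofReal A) (m : ℕ) (t : ℝ) :
    ∫⁻ ξ, (ENNReal.ofReal ((1 + ‖ξ‖) ^ m) * ‖((galerkinLimit ha A t : 𝓗) : ℝ³ → ℂ³) ξ‖ₑ) ^ 2 ≤
      ENNReal.ofReal (momentBound ha A (max m 1)) := by
  refine (lintegral_mono fun ξ => ?_).trans (lintegral_weight_galerkinLimit_sq_le ha hA hM (le_max_right m 1) t)
  gcongr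
  · exact one_le_one_add_norm ξ
  · exact le_max_left m 1

end Moments

/-! ### Norm bounds for the coefficient fields of an element with finite moments -/

section CoeffBounds

/-- Components inherit the weighted moments of the fibre norm. [folklore] -/
theorem lintegral_weight_coeff_sq_le {m : ℕ} {v : 𝓗} {B : ℝ≥0∞}
    (hB : ∫⁻ ξ, (ENNReal.ofReal ((1 + ‖ξ‖) ^ m) * ‖(v : ℝ³ → ℂ³) ξ‖ₑ) ^ 2 ≤ B) (l : Fin 3) :
    ∫⁻ ξ, (ENNReal.ofReal ((1 + ‖ξ‖) ^ m) * ‖coeff v ξ l‖ₑ) ^ 2 ≤ B := by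
  refine (lintegral_mono fun ξ => ?_).trans hB
  gcongr
  rw [← ofReal_norm, ← ofReal_norm]
  exact ENNReal.ofReal_le_ofReal (norm_coeff_le v ξ l)

/-- `‖·‖`-weighted `L²` norms of the components by the moment of order `m + 1`:
`∫⁻ (‖ξ‖(1+‖ξ‖)^m |v_l|)² ≤ ∫⁻ ((1+‖ξ‖)^{m+1}‖v‖)²`. [folklore] -/
theorem lintegral_norm_weight_coeff_sq_le (m : ℕ) (v : 𝓗) (l : Fin 3) :
    ∫⁻ ξ, (ENNReal.ofReal ‖ξ‖ * (ENNReal.ofReal ((1 + ‖ξ‖) ^ m) * ‖coeff v ξ l‖ₑ)) ^ 2 ≤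
      ∫⁻ ξ, (ENNReal.ofReal ((1 + ‖ξ‖) ^ (m + 1)) * ‖(v : ℝ³ → ℂ³) ξ‖ₑ) ^ 2 := by
  refine lintegral_mono fun ξ => ?_
  rw [← mul_assoc, ← ENNReal.ofReal_mul (norm_nonneg _)]
  gcongr
  · calc ‖ξ‖ * (1 + ‖ξ‖) ^ m ≤ (1 + ‖ξ‖) * (1 + ‖ξ‖) ^ m := by gcongr; linarith [norm_nonneg ξ]
      _ = (1 + ‖ξ‖) ^ (m + 1) := by ring
  · rw [← ofReal_norm, ← ofReal_norm]
    exact ENNReal.ofReal_le_ofReal (norm_coeff_le v ξ l)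

/-- **`L¹` norm of a component by the moment of order `2`**: `∫⁻ |v_l| ≤ W (∫⁻((1+‖ξ‖)²‖v‖)²)^{1/2}`.
[folklore] -/
theorem lintegral_enorm_coeff_le (v : 𝓗) (l : Fin 3) :
    ∫⁻ ξ, ‖coeff v ξ l‖ₑ ≤ weightConstENNReal *
      (∫⁻ ξ, (ENNReal.ofReal ((1 + ‖ξ‖) ^ 2) * ‖(v : ℝ³ → ℂ³) ξ‖ₑ) ^ 2) ^ (1 / 2 : ℝ) := by
  have hΦm : AEMeasurable (fun ξ => ‖coeff v ξ l‖ₑ) volume := (aesm_apply (aestronglyMeasurable_coeff v) l).enorm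
  have h1 := sq_lintegral_le_weight hΦm 2
  have h2 := lintegral_weight_coeff_sq_le (m := 2) (v := v) le_rfl l
  calc ∫⁻ ξ, ‖coeff v ξ l‖ₑ ≤ ((∫⁻ ξ : ℝ³, ((ENNReal.ofReal ((1 + ‖ξ‖) ^ 2))⁻¹) ^ 2) *
        ∫⁻ ξ, (ENNReal.ofReal ((1 + ‖ξ‖) ^ 2) * ‖(v : ℝ³ → ℂ³) ξ‖ₑ) ^ 2) ^ (1 / 2 : ℝ) :=
        energy_le_rpow_half_of_sq_le (h1.trans (mul_le_mul_right h2 _))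
    _ = _ := by rw [ENNReal.mul_rpow_of_nonneg _ _ (by norm_num), weightConstENNReal]

/-- **Weighted `L¹` norm of a component by the moment of order `3`**:
`∫⁻ ‖ξ‖|v_l| ≤ W (∫⁻((1+‖ξ‖)³‖v‖)²)^{1/2}`. [folklore] -/
theorem lintegral_norm_mul_coeff_le (v : 𝓗) (l : Fin 3) :
    ∫⁻ ξ, ENNReal.ofReal ‖ξ‖ * ‖coeff v ξ l‖ₑ ≤ weightConstENNReal *
      (∫⁻ ξ, (ENNReal.ofReal ((1 + ‖ξ‖) ^ 3) * ‖(v : ℝ³ → ℂ³) ξ‖ₑ) ^ 2) ^ (1 / 2 : ℝ) := by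
  have hn : Measurable fun η : ℝ³ => ENNReal.ofReal ‖η‖ :=
    ENNReal.continuous_ofReal.measurable.comp continuous_norm.measurable
  have hΦm : AEMeasurable (fun ξ => ENNReal.ofReal ‖ξ‖ * ‖coeff v ξ l‖ₑ) volume :=
    hn.aemeasurable.mul (aesm_apply (aestronglyMeasurable_coeff v) l).enorm
  have h1 := sq_lintegral_le_weight hΦm 2
  have h2 : ∫⁻ ξ, (ENNReal.ofReal ((1 + ‖ξ‖) ^ 2) * (ENNReal.ofReal ‖ξ‖ * ‖coeff v ξ l‖ₑ)) ^ 2 ≤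
      ∫⁻ ξ, (ENNReal.ofReal ((1 + ‖ξ‖) ^ 3) * ‖(v : ℝ³ → ℂ³) ξ‖ₑ) ^ 2 := by
    refine (lintegral_congr fun ξ => by rw [← mul_assoc, mul_comm (ENNReal.ofReal ((1 + ‖ξ‖) ^ 2)),
      mul_assoc]).trans_le (lintegral_norm_weight_coeff_sq_le 2 v l)
  calc ∫⁻ ξ, ENNReal.ofReal ‖ξ‖ * ‖coeff v ξ l‖ₑ ≤ ((∫⁻ ξ : ℝ³, ((ENNReal.ofReal ((1 + ‖ξ‖) ^ 2))⁻¹) ^ 2) *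
        ∫⁻ ξ, (ENNReal.ofReal ((1 + ‖ξ‖) ^ 3) * ‖(v : ℝ³ → ℂ³) ξ‖ₑ) ^ 2) ^ (1 / 2 : ℝ) :=
        energy_le_rpow_half_of_sq_le (h1.trans (mul_le_mul_right h2 _))
    _ = _ := by rw [ENNReal.mul_rpow_of_nonneg _ _ (by norm_num), weightConstENNReal]

/-- Components are in weighted `L²` with the weight `‖ξ‖` when the moment of order `1` is finite. [folklore] -/
theorem memLp_norm_mul_coeff {v : 𝓗}
    (h1 : ∫⁻ ξ, (ENNReal.ofReal ((1 + ‖ξ‖) ^ 1) * ‖(v : ℝ³ → ℂ³) ξ‖ₑ) ^ 2 < ⊤) (l : Fin 3) :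
    MemLp (fun ξ => ((‖ξ‖ : ℝ) : ℂ) * coeff v ξ l) 2 volume := by
  have hm : AEStronglyMeasurable (fun ξ => ((‖ξ‖ : ℝ) : ℂ) * coeff v ξ l) volume :=
    (Complex.continuous_ofReal.comp continuous_norm).aestronglyMeasurable.mul
      (aesm_apply (aestronglyMeasurable_coeff v) l)
  refine ⟨hm, ?_⟩
  rw [← lintegral_enorm_sq_rpow_half_eq_eLpNorm]
  refine ENNReal.rpow_lt_top_of_nonneg (by norm_num) (lt_top_iff_ne_top.1 ?_)
  refine lt_of_le_of_lt (lintegral_mono fun ξ => ?_) ((lintegral_norm_weight_coeff_sq_le 0 v l).trans_lt h1)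
  rw [enorm_mul, ← ofReal_norm (((‖ξ‖ : ℝ)) : ℂ), Complex.norm_real, Real.norm_of_nonneg (norm_nonneg _),
    pow_zero, ENNReal.ofReal_one, one_mul]

/-- Components are integrable with the weight `‖ξ‖` when the moment of order `3` is finite. [folklore] -/
theorem integrable_norm_mul_coeff {v : 𝓗}
    (h3 : ∫⁻ ξ, (ENNReal.ofReal ((1 + ‖ξ‖) ^ 3) * ‖(v : ℝ³ → ℂ³) ξ‖ₑ) ^ 2 < ⊤) (l : Fin 3) :
    Integrable (fun ξ => ((‖ξ‖ : ℝ) : ℂ) * coeff v ξ l) volume := by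
  have hm : AEStronglyMeasurable (fun ξ => ((‖ξ‖ : ℝ) : ℂ) * coeff v ξ l) volume :=
    (Complex.continuous_ofReal.comp continuous_norm).aestronglyMeasurable.mul
      (aesm_apply (aestronglyMeasurable_coeff v) l)
  refine ⟨hm, ?_⟩
  rw [hasFiniteIntegral_iff_enorm]
  have h := lintegral_norm_mul_coeff_le v l
  refine lt_of_le_of_lt (le_of_eq (lintegral_congr fun ξ => ?_)) (h.trans_lt ?_)
  · rw [enorm_mul, ← ofReal_norm (((‖ξ‖ : ℝ)) : ℂ), Complex.norm_real, Real.norm_of_nonneg (norm_nonneg _)]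
  · exact ENNReal.mul_lt_top weightConstENNReal_lt_top (ENNReal.rpow_lt_top_of_nonneg (by norm_num) h3.ne)

/-- Components are integrable when the moment of order `2` is finite. [folklore] -/
theorem integrable_coeff {v : 𝓗}
    (h2 : ∫⁻ ξ, (ENNReal.ofReal ((1 + ‖ξ‖) ^ 2) * ‖(v : ℝ³ → ℂ³) ξ‖ₑ) ^ 2 < ⊤) (l : Fin 3) :
    Integrable (fun ξ => coeff v ξ l) volume := by
  refine ⟨aesm_apply (aestronglyMeasurable_coeff v) l, ?_⟩
  rw [hasFiniteIntegral_iff_enorm]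
  exact (lintegral_enorm_coeff_le v l).trans_lt (ENNReal.mul_lt_top weightConstENNReal_lt_top
    (ENNReal.rpow_lt_top_of_nonneg (by norm_num) h2.ne))

end CoeffBounds

/-! ### The coefficient field of the limit and the nonlinearity along it -/

section Representative

variable {a : ℝ³ → Fin 3 → ℂ} {A : ℝ}

/-- The coefficient field `Ṽ(s) = coeff V(s)` of the Galerkin limit (a fixed representative). [folklore] -/
def limitCoeff (ha : IsSobolevFourierDatum a) (A : ℝ) (s : ℝ) : ℝ³ → Fin 3 → ℂ :=
  coeff (galerkinLimit ha A s)

/-- The nonlinearity along the Galerkin limit, `N(Ṽ(s), Ṽ(s))(ξ)`. [folklore] -/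
def limitNonlin (ha : IsSobolevFourierDatum a) (A : ℝ) (s : ℝ) (ξ : ℝ³) : Fin 3 → ℂ :=
  nonlin (limitCoeff ha A s) (limitCoeff ha A s) ξ

/-- Unfolding `limitNonlin`. [folklore] -/
theorem limitNonlin_apply (ha : IsSobolevFourierDatum a) (A : ℝ) (s : ℝ) (ξ : ℝ³) :
    limitNonlin ha A s ξ = nonlin (limitCoeff ha A s) (limitCoeff ha A s) ξ := rfl

/-- `L²`-distance of coefficient fields is controlled by the distance in `𝓗`. [folklore] -/
theorem eLpNorm_coeff_sub_le (v w : 𝓗) (l : Fin 3) :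
    eLpNorm (fun ξ => coeff v ξ l - coeff w ξ l) 2 volume ≤ ENNReal.ofReal ‖v - w‖ := by
  have h := eLpNorm_coeff_le (v - w) l
  rw [Lp.enorm_def, eLpNorm_coe_eq_ofReal_norm] at h
  refine (le_of_eq (eLpNorm_congr_ae ?_)).trans h
  filter_upwards [coeff_sub_ae v w] with ξ hξ
  exact (hξ l).symm

variable (ha : IsSobolevFourierDatum a) (hA : 0 ≤ A)
  (hM : ∫⁻ ξ, ENNReal.ofReal ((1 + ‖ξ‖) ^ 6) * ∑ l, ‖a ξ l‖ₑ ^ 2 ≤ ENNReal.ofReal A)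
include hA hM

/-- The components of `Ṽ` are `L²`-continuous families in time. [folklore] -/
theorem tendsto_eLpNorm_limitCoeff_sub (l : Fin 3) (s₀ : ℝ) :
    Tendsto (fun s => eLpNorm ((fun ξ => limitCoeff ha A s ξ l) - fun ξ => limitCoeff ha A s₀ ξ l) 2 volume)
      (𝓝 s₀) (𝓝 0) := by
  have hc := (continuous_galerkinLimit ha hA hM).tendsto s₀
  have h1 : Tendsto (fun s => ENNReal.ofReal ‖galerkinLimit ha A s - galerkinLimit ha A s₀‖) (𝓝 s₀) (𝓝 0) := by
    have := ((continuous_norm.tendsto _).comp (hc.sub_const (galerkinLimit ha A s₀)))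
    rw [sub_self, norm_zero] at this
    simpa using ENNReal.tendsto_ofReal this
  refine tendsto_of_tendsto_of_tendsto_of_le_of_le tendsto_const_nhds h1 (fun _ => zero_le) fun s => ?_
  exact eLpNorm_coeff_sub_le _ _ l

/-- **Joint continuity of the nonlinearity along the limit** in `(s, ξ)`. [folklore] -/
theorem continuous_limitNonlin (l : Fin 3) :
    Continuous fun p : ℝ × ℝ³ => limitNonlin ha A p.1 p.2 l := by
  simp only [limitNonlin_apply, nonlin_apply]
  refine continuous_const.mul (continuous_finsetSum _ fun j _ => continuous_finsetSum _ fun k _ => ?_)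
  refine ((Complex.continuous_ofReal.comp (continuous_lerayDerivSymbol j k l)).comp continuous_snd).mul ?_
  exact continuous_fconv_family (F := fun s η => limitCoeff ha A s η j) (G := fun s η => limitCoeff ha A s η k)
    (fun s => memLp_coeff _ j) (fun s => memLp_coeff _ k)
    (tendsto_eLpNorm_limitCoeff_sub ha hA hM j) (tendsto_eLpNorm_limitCoeff_sub ha hA hM k)

/-- Continuity of a component of the nonlinearity along the limit in time. [folklore] -/
theorem continuous_limitNonlin_left_apply (ξ : ℝ³) (l : Fin 3) :
    Continuous fun s : ℝ => limitNonlin ha A s ξ l := by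
  have hg : Continuous fun s : ℝ => (s, ξ) := continuous_id.prodMk continuous_const
  have h := (continuous_limitNonlin ha hA hM l).comp hg
  exact h

/-- Continuity of a component of the nonlinearity along the limit in the frequency. [folklore] -/
theorem continuous_limitNonlin_right_apply (s : ℝ) (l : Fin 3) :
    Continuous fun ξ : ℝ³ => limitNonlin ha A s ξ l := by
  have hg : Continuous fun ξ : ℝ³ => (s, ξ) := continuous_const.prodMk continuous_id
  have h := (continuous_limitNonlin ha hA hM l).comp hg
  exact h

/-- Continuity of the nonlinearity along the limit in time, at a fixed frequency. [folklore] -/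
theorem continuous_limitNonlin_left (ξ : ℝ³) : Continuous fun s : ℝ => limitNonlin ha A s ξ :=
  continuous_pi fun l => continuous_limitNonlin_left_apply ha hA hM ξ l

/-- Continuity of the nonlinearity along the limit in the frequency, at a fixed time. [folklore] -/
theorem continuous_limitNonlin_right (s : ℝ) : Continuous fun ξ : ℝ³ => limitNonlin ha A s ξ :=
  continuous_pi fun l => continuous_limitNonlin_right_apply ha hA hM s l

omit hA hM in
/-- `Ṽ(s)` is divergence free and conjugation symmetric a.e. [folklore] -/
theorem limitCoeff_divFree_conjSymm (hA : 0 ≤ A)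
    (hM : ∫⁻ ξ, ENNReal.ofReal ((1 + ‖ξ‖) ^ 6) * ∑ l, ‖a ξ l‖ₑ ^ 2 ≤ ENNReal.ofReal A) (s : ℝ) :
    (∀ᵐ ξ ∂(volume : Measure ℝ³), ∑ l, ((ξ l : ℝ) : ℂ) * limitCoeff ha A s ξ l = 0) ∧
      ∀ᵐ ξ ∂(volume : Measure ℝ³), ∀ l, limitCoeff ha A s (-ξ) l = conj (limitCoeff ha A s ξ l) :=
  (mem_symSubspace_iff _).1 (galerkinLimit_mem ha hA hM s)

/-- **Weighted pointwise bound for the nonlinearity along the limit**: for every `K` there is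
`C` with `(1+‖ξ‖)^K ‖N(Ṽ(s),Ṽ(s))(ξ)_l‖ ≤ C` for all `s, ξ, l` (transport of the derivative onto
the divergence-free transporting factor, Peetre, Cauchy–Schwarz, and the uniform moments of the
limit). [folklore] -/
theorem exists_weight_mul_norm_limitNonlin_le (K : ℕ) :
    ∃ C : ℝ, ∀ s ξ l, (1 + ‖ξ‖) ^ K * ‖limitNonlin ha A s ξ l‖ ≤ C := by
  -- the moments entering the bound
  set B₀ : ℝ≥0∞ := ENNReal.ofReal (momentBound ha A (max 0 1)) with hB₀
  set B₁ : ℝ≥0∞ := ENNReal.ofReal (momentBound ha A (max (K + 1) 1)) with hB₁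
  set BK : ℝ≥0∞ := ENNReal.ofReal (momentBound ha A (max K 1)) with hBK
  set Bw : ℝ≥0∞ := ENNReal.ofReal (momentBound ha A (max 1 1)) with hBw
  -- the `ℝ≥0∞` constant
  set C : ℝ≥0∞ := ENNReal.ofReal (4 * π) * (9 * (2 ^ K * (Bw ^ (1 / 2 : ℝ) * BK ^ (1 / 2 : ℝ) +
    B₁ ^ (1 / 2 : ℝ) * B₀ ^ (1 / 2 : ℝ)))) with hC
  have hCtop : C ≠ ⊤ := by
    have h2 : ∀ x : ℝ, ENNReal.ofReal x ^ (1 / 2 : ℝ) ≠ ⊤ := fun x =>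
      ENNReal.rpow_ne_top_of_nonneg (by norm_num) ENNReal.ofReal_ne_top
    simp only [hC, hB₀, hB₁, hBK, hBw]
    refine ENNReal.mul_ne_top ENNReal.ofReal_ne_top (ENNReal.mul_ne_top (by norm_num) (ENNReal.mul_ne_top
      (ENNReal.pow_ne_top (by norm_num)) (ENNReal.add_ne_top.2 ⟨ENNReal.mul_ne_top (h2 _) (h2 _),
        ENNReal.mul_ne_top (h2 _) (h2 _)⟩)))
  refine ⟨C.toReal, fun s ξ l => ?_⟩
  set v : 𝓗 := galerkinLimit ha A s with hv
  have hn : Measurable fun η : ℝ³ => ENNReal.ofReal ‖η‖ :=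
    ENNReal.continuous_ofReal.measurable.comp continuous_norm.measurable
  -- hypotheses of the pointwise bound
  obtain ⟨hdiv, -⟩ := limitCoeff_divFree_conjSymm ha hA hM s
  have h2 : ∀ j, MemLp (fun ζ => limitCoeff ha A s ζ j) 2 volume := fun j => memLp_coeff _ j
  have hm1 : ∫⁻ ξ, (ENNReal.ofReal ((1 + ‖ξ‖) ^ 1) * ‖(v : ℝ³ → ℂ³) ξ‖ₑ) ^ 2 < ⊤ :=
    (lintegral_weight_galerkinLimit_sq_le ha hA hM le_rfl s).trans_lt ENNReal.ofReal_lt_top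
  have hw : ∀ k, MemLp (fun η => ((‖η‖ : ℝ) : ℂ) * limitCoeff ha A s η k) 2 volume := fun k =>
    memLp_norm_mul_coeff hm1 k
  have hpt := enorm_nonlin_le_of_divFree hdiv h2 h2 hw ξ l
  -- the weighted convolution bound
  set Φ : Fin 3 → ℝ³ → ℝ≥0∞ := fun k η => ENNReal.ofReal ‖η‖ * ‖limitCoeff ha A s η k‖ₑ with hΦ
  set Ψ : Fin 3 → ℝ³ → ℝ≥0∞ := fun j ζ => ‖limitCoeff ha A s ζ j‖ₑ with hΨ
  have hΦm : ∀ k, AEMeasurable (Φ k) volume := fun k => hn.aemeasurable.mul (h2 k).1.enorm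
  have hΨm : ∀ j, AEMeasurable (Ψ j) volume := fun j => (h2 j).1.enorm
  have hΨ2 : ∀ j, (∫⁻ ζ, Ψ j ζ ^ 2) ^ (1 / 2 : ℝ) ≤ B₀ ^ (1 / 2 : ℝ) := fun j => by
    refine ENNReal.rpow_le_rpow ?_ (by norm_num)
    have h := lintegral_weight_coeff_sq_le (lintegral_weight_zero_galerkinLimit_sq_le ha hA hM 0 s) j
    refine (lintegral_mono fun ζ => ?_).trans h
    rw [pow_zero, ENNReal.ofReal_one, one_mul]
    exact le_of_eq rfl
  have hΨK : ∀ j, (∫⁻ ζ, (ENNReal.ofReal ((1 + ‖ζ‖) ^ K) * Ψ j ζ) ^ 2) ^ (1 / 2 : ℝ) ≤ BK ^ (1 / 2 : ℝ) :=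
    fun j => ENNReal.rpow_le_rpow (lintegral_weight_coeff_sq_le
      (lintegral_weight_zero_galerkinLimit_sq_le ha hA hM K s) j) (by norm_num)
  have hΦ2 : ∀ k, (∫⁻ η, Φ k η ^ 2) ^ (1 / 2 : ℝ) ≤ Bw ^ (1 / 2 : ℝ) := fun k => by
    refine ENNReal.rpow_le_rpow ?_ (by norm_num)
    have h := (lintegral_norm_weight_coeff_sq_le 0 v k).trans (lintegral_weight_zero_galerkinLimit_sq_le ha hA hM 1 s)
    refine (lintegral_mono fun η => le_of_eq ?_).trans h
    simp only [hΦ, pow_zero, ENNReal.ofReal_one, one_mul]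
    rfl
  have hΦK : ∀ k, (∫⁻ η, (ENNReal.ofReal ((1 + ‖η‖) ^ K) * Φ k η) ^ 2) ^ (1 / 2 : ℝ) ≤ B₁ ^ (1 / 2 : ℝ) :=
    fun k => by
    refine ENNReal.rpow_le_rpow ?_ (by norm_num)
    have h := (lintegral_norm_weight_coeff_sq_le K v k).trans
      (lintegral_weight_zero_galerkinLimit_sq_le ha hA hM (K + 1) s)
    refine (lintegral_mono fun η => le_of_eq ?_).trans h
    simp only [hΦ]
    rw [← mul_assoc, mul_comm (ENNReal.ofReal ((1 + ‖η‖) ^ K)), mul_assoc]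
    rfl
  have hconv : ∀ j k, ENNReal.ofReal ((1 + ‖ξ‖) ^ K) * (Φ k ⋆ₗ Ψ j) ξ ≤
      2 ^ K * (Bw ^ (1 / 2 : ℝ) * BK ^ (1 / 2 : ℝ) + B₁ ^ (1 / 2 : ℝ) * B₀ ^ (1 / 2 : ℝ)) := fun j k => by
    refine (weight_mul_lconv_le (hΦm k) (hΨm j) K ξ).trans ?_
    gcongr
    · refine (lconv_le_sqrt_mul_sqrt (hΦm k) ((measurable_ofReal_weight K).aemeasurable.mul (hΨm j)) ξ).trans ?_
      exact mul_le_mul' (hΦ2 k) (hΨK j)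
    · refine (lconv_le_sqrt_mul_sqrt ((measurable_ofReal_weight K).aemeasurable.mul (hΦm k)) (hΨm j) ξ).trans ?_
      exact mul_le_mul' (hΦK k) (hΨ2 j)
  have hmain : ENNReal.ofReal ((1 + ‖ξ‖) ^ K) * ‖limitNonlin ha A s ξ l‖ₑ ≤ C := by
    rw [limitNonlin_apply]
    calc ENNReal.ofReal ((1 + ‖ξ‖) ^ K) * ‖nonlin (limitCoeff ha A s) (limitCoeff ha A s) ξ l‖ₑ
        ≤ ENNReal.ofReal ((1 + ‖ξ‖) ^ K) * (ENNReal.ofReal (4 * π) * ∑ j, ∑ k, (Φ k ⋆ₗ Ψ j) ξ) :=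
          mul_le_mul_right hpt _
      _ = ENNReal.ofReal (4 * π) * ∑ j, ∑ k, ENNReal.ofReal ((1 + ‖ξ‖) ^ K) * (Φ k ⋆ₗ Ψ j) ξ := by
          rw [mul_left_comm, Finset.mul_sum]
          congr 1
          refine Finset.sum_congr rfl fun j _ => ?_
          rw [Finset.mul_sum]
      _ ≤ ENNReal.ofReal (4 * π) * ∑ _j : Fin 3, ∑ _k : Fin 3,
            2 ^ K * (Bw ^ (1 / 2 : ℝ) * BK ^ (1 / 2 : ℝ) + B₁ ^ (1 / 2 : ℝ) * B₀ ^ (1 / 2 : ℝ)) :=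
          mul_le_mul_right (Finset.sum_le_sum fun j _ => Finset.sum_le_sum fun k _ => hconv j k) _
      _ = C := by rw [hC]; simp; ring
  -- to real numbers
  have h1 : ENNReal.ofReal ((1 + ‖ξ‖) ^ K * ‖limitNonlin ha A s ξ l‖) ≤ C := by
    rwa [ENNReal.ofReal_mul (by positivity), ofReal_norm]
  exact (ENNReal.ofReal_le_iff_le_toReal hCtop).1 h1

/-- **Pointwise decay of the nonlinearity along the limit** in the sup norm of the fibre:
`‖N(Ṽ(s),Ṽ(s))(ξ)‖ ≤ C_K (1+‖ξ‖)^{-K}`. [folklore] -/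
theorem exists_norm_limitNonlin_le (K : ℕ) :
    ∃ C : ℝ, 0 ≤ C ∧ ∀ s ξ, ‖limitNonlin ha A s ξ‖ ≤ C * ((1 + ‖ξ‖) ^ K)⁻¹ := by
  obtain ⟨C, hC⟩ := exists_weight_mul_norm_limitNonlin_le ha hA hM K
  have hC0 : 0 ≤ C := le_trans (by positivity) (hC 0 0 0)
  refine ⟨C, hC0, fun s ξ => ?_⟩
  have hw : 0 < (1 + ‖ξ‖) ^ K := by positivity
  refine (pi_norm_le_iff_of_nonneg (by positivity)).2 fun l => ?_
  rw [← div_eq_mul_inv, le_div_iff₀ hw, mul_comm]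
  exact hC s ξ l

end Representative

/-! ### Test elements: indicators of bounded sets in one component -/

section Test

variable {S : Set ℝ³} {l : Fin 3}

/-- The test field `1_S e_l`. [folklore] -/
def testField (S : Set ℝ³) (l : Fin 3) : ℝ³ → ℂ³ :=
  S.indicator fun _ => (EuclideanSpace.equiv (Fin 3) ℂ).symm fun l' => if l' = l then (1 : ℂ) else 0

/-- The test field of a measurable set of finite measure is square integrable. [folklore] -/
theorem memLp_testField (hS : MeasurableSet S) (hμ : volume S ≠ ⊤) (l : Fin 3) :
    MemLp (testField S l) 2 volume :=
  memLp_indicator_const 2 hS _ (Or.inr hμ)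

/-- The test element `1_S e_l ∈ 𝓗`. [folklore] -/
def testLp (hS : MeasurableSet S) (hμ : volume S ≠ ⊤) (l : Fin 3) : 𝓗 := (memLp_testField hS hμ l).toLp _

/-- Coefficients of the test element, a.e.: `coeff (1_S e_l) ξ l' = 1_S(ξ) δ_{l l'}`. [folklore] -/
theorem coeff_testLp_ae (hS : MeasurableSet S) (hμ : volume S ≠ ⊤) (l : Fin 3) :
    ∀ᵐ ξ ∂(volume : Measure ℝ³), ∀ l', coeff (testLp hS hμ l) ξ l' =
      S.indicator (fun _ => if l' = l then (1 : ℂ) else 0) ξ := by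
  filter_upwards [MemLp.coeFn_toLp (memLp_testField hS hμ l)] with ξ hξ
  intro l'
  rw [coeff_apply, testLp, hξ, testField]
  by_cases h : ξ ∈ S
  · rw [Set.indicator_of_mem h, Set.indicator_of_mem h]; rfl
  · rw [Set.indicator_of_notMem h, Set.indicator_of_notMem h]; rfl

/-- **The pairing with a test element is a set integral of one component**:
`∫ ∑_{l'} G_{l'} conj(coeff(1_S e_l))_{l'} = ∫_S G_l`. [folklore] -/
theorem integral_sum_mul_conj_coeff_testLp (hS : MeasurableSet S) (hμ : volume S ≠ ⊤) (l : Fin 3)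
    (G : ℝ³ → Fin 3 → ℂ) :
    ∫ ξ, ∑ l', G ξ l' * conj (coeff (testLp hS hμ l) ξ l') = ∫ ξ in S, G ξ l := by
  rw [← integral_indicator hS]
  refine integral_congr_ae ((coeff_testLp_ae hS hμ l).mono fun ξ hξ => ?_)
  simp only [hξ]
  by_cases h : ξ ∈ S
  · simp only [Set.indicator_of_mem h]
    rw [Finset.sum_eq_single l (fun l' _ hl' => by simp [hl']) (fun h' => absurd (Finset.mem_univ l) h')]
    simp
  · simp only [Set.indicator_of_notMem h, map_zero, mul_zero, Finset.sum_const_zero]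

/-- The inner product with a test element: `⟪1_S e_l, X⟫ = ∫_S (coeff X)_l`. [folklore] -/
theorem inner_testLp (hS : MeasurableSet S) (hμ : volume S ≠ ⊤) (l : Fin 3) (X : 𝓗) :
    ⟪testLp hS hμ l, X⟫_ℂ = ∫ ξ in S, coeff X ξ l := by
  rw [inner_eq_integral_coeff, integral_sum_mul_conj_coeff_testLp]

/-- Truncating a test element supported in the ball of radius `ρ ≤ R` does nothing, a.e. [folklore] -/
theorem truncCoeff_testLp_ae (hS : MeasurableSet S) (hμ : volume S ≠ ⊤) (l : Fin 3) {ρ R : ℝ}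
    (hSρ : S ⊆ closedBall (0 : ℝ³) ρ) (hρR : ρ ≤ R) :
    ∀ᵐ ξ ∂(volume : Measure ℝ³), truncCoeff R (testLp hS hμ l) ξ = coeff (testLp hS hμ l) ξ := by
  filter_upwards [coeff_testLp_ae hS hμ l] with ξ hξ
  funext l'
  rcases le_or_gt ‖ξ‖ R with h | h
  · exact truncCoeff_of_le _ h l'
  · have hξS : ξ ∉ S := fun hmem => by
      have := mem_closedBall_zero_iff.1 (hSρ hmem)
      linarith
    rw [truncCoeff_of_lt _ h, hξ l', Set.indicator_of_notMem hξS]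

end Test

/-! ### The weak form of the Galerkin equations and its limit -/

section Weak

variable {a : ℝ³ → Fin 3 → ℂ} {A : ℝ}

/-- The Galerkin nonlinearity `v ↦ B_R(v, v)` is continuous on `𝓗` (it is locally Lipschitz). [folklore] -/
theorem continuous_galerkinNonlin_self (R : ℝ) : Continuous fun v : 𝓗 => galerkinNonlin R v v := by
  set L : ℝ := 72 * π * max R 0 * (eLpNorm (fun ξ : ℝ³ => cutoff R ξ) 2 volume).toReal with hL
  have hL0 : 0 ≤ L := by rw [hL]; positivity
  refine continuous_iff_continuousAt.2 fun w => ?_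
  rw [ContinuousAt, tendsto_iff_norm_sub_tendsto_zero]
  have hb : ∀ v : 𝓗, ‖galerkinNonlin R v v - galerkinNonlin R w w‖ ≤ L * (‖v - w‖ + 2 * ‖w‖) * ‖v - w‖ :=
    fun v => by
    refine (norm_galerkinNonlin_self_sub_self_le R v w).trans ?_
    rw [← hL]
    have : ‖v‖ + ‖w‖ ≤ ‖v - w‖ + 2 * ‖w‖ := by linarith [norm_le_norm_sub_add v w]
    exact mul_le_mul_of_nonneg_right (mul_le_mul_of_nonneg_left this hL0) (norm_nonneg _)
  have hlim : Tendsto (fun v : 𝓗 => L * (‖v - w‖ + 2 * ‖w‖) * ‖v - w‖) (𝓝 w) (𝓝 0) := by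
    have h1 : Tendsto (fun v : 𝓗 => ‖v - w‖) (𝓝 w) (𝓝 0) := by
      have := tendsto_iff_norm_sub_tendsto_zero.1 (tendsto_id (x := 𝓝 w))
      exact this
    have h2 := ((h1.const_add 0).add_const (2 * ‖w‖)).const_mul L |>.mul h1
    simpa using h2
  exact tendsto_of_tendsto_of_tendsto_of_le_of_le tendsto_const_nhds hlim (fun v => norm_nonneg _) hb

/-- **The weak (integrated) form of the inviscid Galerkin equations**: for every `φ ∈ 𝓗`,
`⟪φ, α_n(t)⟫ = ⟪φ, a⟫ − ∫₀ᵗ ⟪φ, B_{n+1}(α_n(s), α_n(s))⟫ ds` on the lifespan. [folklore] -/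
theorem inner_galerkinSeq_eq (ha : IsSobolevFourierDatum a) (φ : 𝓗) (n : ℕ) {t : ℝ}
    (ht : t ∈ Icc 0 (lifespan A)) :
    ⟪φ, (galerkinSeq ha n t : 𝓗)⟫_ℂ = ⟪φ, datumLp ha⟫_ℂ -
      ∫ s in (0 : ℝ)..t, ⟪φ, galerkinNonlin ((n : ℝ) + 1) (galerkinSeq ha n s : 𝓗) (galerkinSeq ha n s : 𝓗)⟫_ℂ := by
  set τ := lifespan A with hτ
  set α : ℝ → symSubspace := galerkinSeq ha n with hα
  have hder := galerkinSeq_hasDerivWithinAt ha n τ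
  -- derivative of the pairing
  have hH : ∀ s ∈ Icc 0 τ, HasDerivWithinAt (fun s => ⟪φ, (α s : 𝓗)⟫_ℂ)
      (-⟪φ, galerkinNonlin ((n : ℝ) + 1) (α s : 𝓗) (α s : 𝓗)⟫_ℂ) (Icc 0 τ) s := fun s hs => by
    have h1 := (hasDerivWithinAt_const s (Icc 0 τ) φ).inner ℂ
      (hasDerivWithinAt_coe_of_galerkinField (hder s hs))
    refine h1.congr_deriv ?_
    rw [inner_zero_left, add_zero, zero_smul, neg_zero, zero_sub, inner_neg_right]
  have hcontα : ContinuousOn (fun s => (α s : 𝓗)) (Icc 0 τ) := fun s hs =>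
    (hasDerivWithinAt_coe_of_galerkinField (hder s hs)).continuousWithinAt
  have hcont : ContinuousOn (fun s => ⟪φ, (α s : 𝓗)⟫_ℂ) (Icc 0 t) := fun s hs =>
    ((hH s ⟨hs.1, hs.2.trans ht.2⟩).continuousWithinAt).mono (Icc_subset_Icc_right ht.2)
  have hderiv : ∀ s ∈ Ioo 0 t, HasDerivWithinAt (fun s => ⟪φ, (α s : 𝓗)⟫_ℂ)
      (-⟪φ, galerkinNonlin ((n : ℝ) + 1) (α s : 𝓗) (α s : 𝓗)⟫_ℂ) (Ioi s) s := fun s hs =>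
    ((hH s ⟨hs.1.le, hs.2.le.trans ht.2⟩).hasDerivAt (Icc_mem_nhds hs.1 (hs.2.trans_le ht.2))).hasDerivWithinAt
  have hint : IntervalIntegrable (fun s => -⟪φ, galerkinNonlin ((n : ℝ) + 1) (α s : 𝓗) (α s : 𝓗)⟫_ℂ) volume 0 t := by
    refine (ContinuousOn.neg ?_).intervalIntegrable_of_Icc ht.1
    have hc : ContinuousOn (fun s => galerkinNonlin ((n : ℝ) + 1) (α s : 𝓗) (α s : 𝓗)) (Icc 0 t) :=
      (continuous_galerkinNonlin_self _).comp_continuousOn (hcontα.mono (Icc_subset_Icc_right ht.2))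
    exact continuousOn_const.inner hc
  have hftc := intervalIntegral.integral_eq_sub_of_hasDeriv_right_of_le ht.1 hcont hderiv hint
  rw [intervalIntegral.integral_neg] at hftc
  have h0 : (α 0 : 𝓗) = datumLp ha := by rw [hα, galerkinSeq_zero, coe_datumSym]
  rw [h0] at hftc
  linear_combination -hftc

end Weak

/-! ### Convergence of the nonlinear pairings against test elements -/

section Convergence

variable {a : ℝ³ → Fin 3 → ℂ} {A : ℝ}

/-- **Pointwise bound for the nonlinearity of two fields by their `L²` norms** (sup norm of the
fibre): `‖N(p,q)(ξ)‖ ≤ C_N ‖ξ‖ ‖q‖₂ ‖p‖₂` (envelope bound and Cauchy–Schwarz). [folklore] -/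
theorem enorm_nonlin_le_mul_rpow {p q : ℝ³ → Fin 3 → ℂ} (hp : AEStronglyMeasurable p volume)
    (hq : AEStronglyMeasurable q volume) (ξ : ℝ³) :
    ‖nonlin p q ξ‖ₑ ≤ FujitaKato.nonlinC (Fin 3) * ‖ξ‖ₑ *
      ((∫⁻ η, ‖p η‖ₑ ^ 2) ^ (1 / 2 : ℝ) * (∫⁻ η, ‖q η‖ₑ ^ 2) ^ (1 / 2 : ℝ)) := by
  refine (FujitaKato.enorm_nonlin_le p q ξ).trans ?_
  rw [FujitaKato.lconv_eq_lconvolution]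
  exact mul_le_mul_right (lconv_le_sqrt_mul_sqrt hp.enorm hq.enorm ξ) _

/-- The `L²` norm (sup norm of the fibre) of a truncated field is at most the norm in `𝓗`. [folklore] -/
theorem lintegral_enorm_truncCoeff_sq_rpow_le (R : ℝ) (v : 𝓗) :
    (∫⁻ η, ‖truncCoeff R v η‖ₑ ^ 2) ^ (1 / 2 : ℝ) ≤ ENNReal.ofReal ‖v‖ := by
  rw [← eLpNorm_coe_eq_ofReal_norm, ← lintegral_enorm_sq_rpow_half_eq_eLpNorm]
  refine ENNReal.rpow_le_rpow (lintegral_mono fun η => ?_) (by norm_num)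
  gcongr
  rw [← ofReal_norm, ← ofReal_norm]
  refine ENNReal.ofReal_le_ofReal ((pi_norm_le_iff_of_nonneg (norm_nonneg _)).2 fun l => ?_)
  exact (norm_truncCoeff_le R v η l).trans (norm_coeff_le v η l)

/-- The `L²` norm (sup norm of the fibre) of a coefficient field is at most the norm in `𝓗`. [folklore] -/
theorem lintegral_enorm_coeff_sq_rpow_le (v : 𝓗) :
    (∫⁻ η, ‖coeff v η‖ₑ ^ 2) ^ (1 / 2 : ℝ) ≤ ENNReal.ofReal ‖v‖ := by
  rw [← eLpNorm_coe_eq_ofReal_norm, ← lintegral_enorm_sq_rpow_half_eq_eLpNorm]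
  refine ENNReal.rpow_le_rpow (lintegral_mono fun η => ?_) (by norm_num)
  gcongr
  rw [← ofReal_norm, ← ofReal_norm]
  exact ENNReal.ofReal_le_ofReal ((pi_norm_le_iff_of_nonneg (norm_nonneg _)).2 fun l => norm_coeff_le v η l)

/-- `(a + b)^{1/2} ≤ a^{1/2} + b^{1/2}` and `(x+y)² ≤ 2x² + 2y²` combined:
`(∫⁻ (F+G)²)^{1/2} ≤ 2((∫⁻F²)^{1/2} + (∫⁻G²)^{1/2})`. [folklore] -/
theorem lintegral_add_sq_rpow_le {F G : ℝ³ → ℝ≥0∞} (hF : AEMeasurable F volume) (hG : AEMeasurable G volume) :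
    (∫⁻ η, (F η + G η) ^ 2) ^ (1 / 2 : ℝ) ≤ 2 * ((∫⁻ η, F η ^ 2) ^ (1 / 2 : ℝ) + (∫⁻ η, G η ^ 2) ^ (1 / 2 : ℝ)) := by
  have h1 : ∀ η, (F η + G η) ^ 2 ≤ 2 * F η ^ 2 + 2 * G η ^ 2 := fun η => by
    have : (F η + G η) ^ 2 + 0 ≤ 2 * F η ^ 2 + 2 * G η ^ 2 := by
      calc (F η + G η) ^ 2 + 0 ≤ (F η + G η) ^ 2 + (F η - G η + (G η - F η)) ^ 2 := by gcongr; exact zero_le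
        _ ≤ 2 * F η ^ 2 + 2 * G η ^ 2 := by
            rcases le_total (F η) (G η) with h | h
            · rw [tsub_eq_zero_of_le h, zero_add]
              have : G η = F η + (G η - F η) := (add_tsub_cancel_of_le h).symm
              calc (F η + G η) ^ 2 + (G η - F η) ^ 2 = (F η + (F η + (G η - F η))) ^ 2 + (G η - F η) ^ 2 := by
                    rw [← this]
                _ ≤ 2 * F η ^ 2 + 2 * (F η + (G η - F η)) ^ 2 := by ring_nf; gcongr
                _ = 2 * F η ^ 2 + 2 * G η ^ 2 := by rw [← this]
            · rw [tsub_eq_zero_of_le h, add_zero]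
              have : F η = G η + (F η - G η) := (add_tsub_cancel_of_le h).symm
              calc (F η + G η) ^ 2 + (F η - G η) ^ 2 = ((G η + (F η - G η)) + G η) ^ 2 + (F η - G η) ^ 2 := by
                    rw [← this]
                _ ≤ 2 * (G η + (F η - G η)) ^ 2 + 2 * G η ^ 2 := by ring_nf; gcongr
                _ = 2 * F η ^ 2 + 2 * G η ^ 2 := by rw [← this]
    simpa using this
  calc (∫⁻ η, (F η + G η) ^ 2) ^ (1 / 2 : ℝ) ≤ (∫⁻ η, (2 * F η ^ 2 + 2 * G η ^ 2)) ^ (1 / 2 : ℝ) :=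
        ENNReal.rpow_le_rpow (lintegral_mono h1) (by norm_num)
    _ = (2 * (∫⁻ η, F η ^ 2) + 2 * ∫⁻ η, G η ^ 2) ^ (1 / 2 : ℝ) := by
        rw [lintegral_add_left' ((hF.pow_const 2).const_mul 2), lintegral_const_mul'' _ (hF.pow_const 2),
          lintegral_const_mul'' _ (hG.pow_const 2)]
    _ ≤ (2 * ∫⁻ η, F η ^ 2) ^ (1 / 2 : ℝ) + (2 * ∫⁻ η, G η ^ 2) ^ (1 / 2 : ℝ) :=
        ENNReal.rpow_add_le_add_rpow (p := 1 / 2) _ _ (by norm_num) (by norm_num)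
    _ ≤ 2 * (∫⁻ η, F η ^ 2) ^ (1 / 2 : ℝ) + 2 * (∫⁻ η, G η ^ 2) ^ (1 / 2 : ℝ) := by
        have h2 : (2 : ℝ≥0∞) ^ (1 / 2 : ℝ) ≤ 2 := by
          have : (2 : ℝ≥0∞) ^ (1 / 2 : ℝ) ≤ 2 ^ (1 : ℝ) :=
            ENNReal.rpow_le_rpow_of_exponent_le (by norm_num) (by norm_num)
          rwa [ENNReal.rpow_one] at this
        rw [ENNReal.mul_rpow_of_nonneg _ _ (by norm_num), ENNReal.mul_rpow_of_nonneg _ _ (by norm_num)]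
        gcongr
    _ = _ := by ring

/-- **The truncated Galerkin states approach the coefficient field of the limit in `L²`**
(sup norm of the fibre): `‖χ_R v − coeff w‖₂ ≤ 2(‖v − w‖ + ‖(1−χ_R) w‖₂)` and the tail
`‖(1−χ_R)w‖₂ ≤ (∫⁻((1+‖η‖)‖w‖)²)^{1/2}/(R+1)` for `R ≥ 0`. [folklore] -/
theorem lintegral_enorm_truncCoeff_sub_coeff_sq_rpow_le {R : ℝ} (hR : 0 ≤ R) (v w : 𝓗) :
    (∫⁻ η, ‖truncCoeff R v η - coeff w η‖ₑ ^ 2) ^ (1 / 2 : ℝ) ≤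
      2 * (ENNReal.ofReal ‖v - w‖ + (ENNReal.ofReal (R + 1))⁻¹ *
        (∫⁻ η, (ENNReal.ofReal ((1 + ‖η‖) ^ 1) * ‖(w : ℝ³ → ℂ³) η‖ₑ) ^ 2) ^ (1 / 2 : ℝ)) := by
  set F : ℝ³ → ℝ≥0∞ := fun η => ‖((v - w : 𝓗) : ℝ³ → ℂ³) η‖ₑ with hF
  set G : ℝ³ → ℝ≥0∞ := fun η => ENNReal.ofReal (1 - cutoff R η) * ‖(w : ℝ³ → ℂ³) η‖ₑ with hG
  have hFm : AEMeasurable F volume := (Lp.aestronglyMeasurable (v - w)).enorm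
  have hGm : AEMeasurable G volume :=
    ((measurable_const.sub (measurable_cutoff R)).ennreal_ofReal).aemeasurable.mul (Lp.aestronglyMeasurable w).enorm
  have hae : ∀ᵐ η ∂(volume : Measure ℝ³), ‖truncCoeff R v η - coeff w η‖ₑ ≤ F η + G η := by
    filter_upwards [coeff_sub_ae v w] with η hη
    rw [← ofReal_norm]
    have hc0 := cutoff_nonneg R η
    have hc1 := cutoff_le_one R η
    have h1 : ∀ l, ‖(truncCoeff R v η - coeff w η) l‖ ≤ ‖((v - w : 𝓗) : ℝ³ → ℂ³) η‖ +
        (1 - cutoff R η) * ‖(w : ℝ³ → ℂ³) η‖ := fun l => by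
      have e : (truncCoeff R v η - coeff w η) l = ((cutoff R η : ℝ) : ℂ) * coeff (v - w) η l -
          ((1 - cutoff R η : ℝ) : ℂ) * coeff w η l := by
        rw [Pi.sub_apply, truncCoeff_apply, hη l]; push_cast; ring
      rw [e]
      refine (norm_sub_le _ _).trans (add_le_add ?_ ?_)
      · rw [norm_mul, Complex.norm_real, Real.norm_of_nonneg hc0]
        calc cutoff R η * ‖coeff (v - w) η l‖ ≤ 1 * ‖((v - w : 𝓗) : ℝ³ → ℂ³) η‖ :=
              mul_le_mul hc1 (norm_coeff_le _ η l) (norm_nonneg _) zero_le_one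
          _ = _ := one_mul _
      · rw [norm_mul, Complex.norm_real, Real.norm_of_nonneg (by linarith)]
        exact mul_le_mul_of_nonneg_left (norm_coeff_le w η l) (by linarith)
    have h2 := (pi_norm_le_iff_of_nonneg (by positivity)).2 h1
    calc ENNReal.ofReal ‖truncCoeff R v η - coeff w η‖
        ≤ ENNReal.ofReal (‖((v - w : 𝓗) : ℝ³ → ℂ³) η‖ + (1 - cutoff R η) * ‖(w : ℝ³ → ℂ³) η‖) :=
          ENNReal.ofReal_le_ofReal h2
      _ = F η + G η := by
          rw [ENNReal.ofReal_add (norm_nonneg _) (by positivity), ofReal_norm,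
            ENNReal.ofReal_mul (by linarith), ofReal_norm]
  have hG2 : (∫⁻ η, G η ^ 2) ^ (1 / 2 : ℝ) ≤ (ENNReal.ofReal (R + 1))⁻¹ *
      (∫⁻ η, (ENNReal.ofReal ((1 + ‖η‖) ^ 1) * ‖(w : ℝ³ → ℂ³) η‖ₑ) ^ 2) ^ (1 / 2 : ℝ) := by
    have hc0 : ENNReal.ofReal (R + 1) ≠ 0 := (ENNReal.ofReal_pos.2 (by linarith)).ne'
    have hct : ENNReal.ofReal (R + 1) ≠ ⊤ := ENNReal.ofReal_ne_top
    have hpt : ∀ η, G η ≤ (ENNReal.ofReal (R + 1))⁻¹ * (ENNReal.ofReal ((1 + ‖η‖) ^ 1) * ‖(w : ℝ³ → ℂ³) η‖ₑ) :=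
      fun η => by
      refine le_inv_mul_of_mul_le hc0 hct ?_
      simp only [hG]
      rw [← mul_assoc, ← ENNReal.ofReal_mul (by linarith)]
      gcongr
      unfold cutoff
      split_ifs with h
      · simp only [sub_self, mul_zero]; positivity
      · push Not at h; rw [pow_one]; nlinarith
    calc (∫⁻ η, G η ^ 2) ^ (1 / 2 : ℝ) ≤ (∫⁻ η, ((ENNReal.ofReal (R + 1))⁻¹ *
          (ENNReal.ofReal ((1 + ‖η‖) ^ 1) * ‖(w : ℝ³ → ℂ³) η‖ₑ)) ^ 2) ^ (1 / 2 : ℝ) :=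
          ENNReal.rpow_le_rpow (lintegral_mono fun η => pow_le_pow_left₀ bot_le (hpt η) 2) (by norm_num)
      _ = _ := by
          simp_rw [mul_pow]
          rw [lintegral_const_mul' _ _ (ENNReal.pow_ne_top (ENNReal.inv_ne_top.2 hc0)),
            ENNReal.mul_rpow_of_nonneg _ _ (by norm_num), energy_sq_rpow_half]
  have hF2 : (∫⁻ η, F η ^ 2) ^ (1 / 2 : ℝ) = ENNReal.ofReal ‖v - w‖ := by
    rw [hF, lintegral_enorm_sq_rpow_half_eq_eLpNorm, eLpNorm_coe_eq_ofReal_norm]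
  calc (∫⁻ η, ‖truncCoeff R v η - coeff w η‖ₑ ^ 2) ^ (1 / 2 : ℝ)
      ≤ (∫⁻ η, (F η + G η) ^ 2) ^ (1 / 2 : ℝ) :=
        ENNReal.rpow_le_rpow (lintegral_mono_ae (hae.mono fun η hη => pow_le_pow_left₀ bot_le hη 2)) (by norm_num)
    _ ≤ 2 * ((∫⁻ η, F η ^ 2) ^ (1 / 2 : ℝ) + (∫⁻ η, G η ^ 2) ^ (1 / 2 : ℝ)) := lintegral_add_sq_rpow_le hFm hGm
    _ ≤ _ := by rw [hF2]; gcongr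

variable (ha : IsSobolevFourierDatum a) (hA : 0 ≤ A)
  (hM : ∫⁻ ξ, ENNReal.ofReal ((1 + ‖ξ‖) ^ 6) * ∑ l, ‖a ξ l‖ₑ ^ 2 ≤ ENNReal.ofReal A)
include hA hM

/-- The norm of the Galerkin limit is at most the norm of the datum. [folklore] -/
theorem norm_galerkinLimit_le (t : ℝ) : ‖galerkinLimit ha A t‖ ≤ ‖datumLp ha‖ := by
  refine le_of_tendsto (tendsto_galerkinSeq ha hA hM t).norm (Eventually.of_forall fun n => ?_)
  have h := norm_le_norm_zero_of_galerkin_solution le_rfl ((n : ℝ) + 1)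
    (galerkinSeq_hasDerivWithinAt ha n (lifespan A)) (t := clamp (lifespan A) t)
    ⟨clamp_nonneg _ _, clamp_le (lifespan_pos hA).le _⟩
  rw [galerkinSeq_zero] at h
  exact h

omit hA hM in
/-- The norm of the Galerkin states is at most the norm of the datum. [folklore] -/
theorem norm_galerkinSeq_le (n : ℕ) {t : ℝ} (ht : t ∈ Icc 0 (lifespan A)) :
    ‖(galerkinSeq ha n t : 𝓗)‖ ≤ ‖datumLp ha‖ := by
  have h := norm_le_norm_zero_of_galerkin_solution le_rfl ((n : ℝ) + 1)
    (galerkinSeq_hasDerivWithinAt ha n (lifespan A)) ht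
  rw [galerkinSeq_zero] at h
  exact h

/-- The rate at which the truncated Galerkin states approach the limit field, `δ_n = const/(n+2)`.
[folklore] -/
def approxRate (ha : IsSobolevFourierDatum a) (A : ℝ) (n : ℕ) : ℝ :=
  2 * (cauchyConst A + Real.sqrt (momentBound ha A 1)) / ((n : ℝ) + 2)

omit hA hM in
/-- `δ_n → 0`. [folklore] -/
theorem tendsto_approxRate : Tendsto (approxRate ha A) atTop (𝓝 0) :=
  tendsto_const_div_add_two _

omit hA hM in
/-- `δ_n ≥ 0`. [folklore] -/
theorem approxRate_nonneg (hA : 0 ≤ A) (n : ℕ) : 0 ≤ approxRate ha A n := by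
  unfold approxRate; have := cauchyConst_nonneg hA; positivity

/-- **The truncated Galerkin states approach the limit field**:
`‖χ_{n+1}α_n(s) − Ṽ(s)‖₂ ≤ δ_n` on the lifespan. [cite: MajdaBertozzi2002, Thm. 3.4 proof, (3.64) p. 109] -/
theorem lintegral_enorm_truncCoeff_galerkinSeq_sub_limitCoeff_le (n : ℕ) {s : ℝ} (hs : s ∈ Icc 0 (lifespan A)) :
    (∫⁻ η, ‖truncCoeff ((n : ℝ) + 1) (galerkinSeq ha n s : 𝓗) η - limitCoeff ha A s η‖ₑ ^ 2) ^ (1 / 2 : ℝ) ≤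
      ENNReal.ofReal (approxRate ha A n) := by
  have h1 := lintegral_enorm_truncCoeff_sub_coeff_sq_rpow_le (by positivity : (0 : ℝ) ≤ (n : ℝ) + 1)
    (galerkinSeq ha n s : 𝓗) (galerkinLimit ha A s)
  refine h1.trans ?_
  have h2 : ‖(galerkinSeq ha n s : 𝓗) - galerkinLimit ha A s‖ ≤ cauchyConst A / ((n : ℝ) + 2) := by
    have h := norm_galerkinSeq_sub_galerkinLimit_le ha hA hM n s
    rwa [clamp_of_mem hs] at h
  have h3 : (∫⁻ η, (ENNReal.ofReal ((1 + ‖η‖) ^ 1) * ‖((galerkinLimit ha A s : 𝓗) : ℝ³ → ℂ³) η‖ₑ) ^ 2) ^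
      (1 / 2 : ℝ) ≤ ENNReal.ofReal (Real.sqrt (momentBound ha A 1)) := by
    refine (ENNReal.rpow_le_rpow (lintegral_weight_galerkinLimit_sq_le ha hA hM le_rfl s) (by norm_num)).trans ?_
    rw [ENNReal.ofReal_rpow_of_nonneg (momentBound_nonneg ha A 1) (by norm_num), Real.sqrt_eq_rpow]
  have hn2 : (0 : ℝ) < (n : ℝ) + 2 := by positivity
  calc 2 * (ENNReal.ofReal ‖(galerkinSeq ha n s : 𝓗) - galerkinLimit ha A s‖ +
        (ENNReal.ofReal ((n : ℝ) + 1 + 1))⁻¹ * (∫⁻ η, (ENNReal.ofReal ((1 + ‖η‖) ^ 1) *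
          ‖((galerkinLimit ha A s : 𝓗) : ℝ³ → ℂ³) η‖ₑ) ^ 2) ^ (1 / 2 : ℝ))
      ≤ 2 * (ENNReal.ofReal (cauchyConst A / ((n : ℝ) + 2)) +
          (ENNReal.ofReal ((n : ℝ) + 2))⁻¹ * ENNReal.ofReal (Real.sqrt (momentBound ha A 1))) := by
        rw [show (n : ℝ) + 1 + 1 = (n : ℝ) + 2 by ring]
        gcongr
    _ = ENNReal.ofReal (approxRate ha A n) := by
        rw [← ENNReal.ofReal_inv_of_pos hn2, ← ENNReal.ofReal_mul (by positivity),
          ← ENNReal.ofReal_add (div_nonneg (cauchyConst_nonneg hA) hn2.le) (by positivity),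
          ← ENNReal.ofReal_ofNat, ← ENNReal.ofReal_mul (by norm_num), approxRate]
        congr 1
        field_simp

/-- **Convergence of the nonlinearity on bounded frequency sets**: for `‖ξ‖ ≤ ρ` and `s` in the
lifespan, `‖N(χα_n, χα_n)(ξ) − N(Ṽ,Ṽ)(ξ)‖ ≤ C_N ρ (2‖a‖) δ_n`. [folklore] -/
theorem norm_nonlin_galerkinSeq_sub_limitNonlin_le (n : ℕ) {s : ℝ} (hs : s ∈ Icc 0 (lifespan A))
    {ρ : ℝ} (hρ : 0 ≤ ρ) {ξ : ℝ³} (hξ : ‖ξ‖ ≤ ρ) :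
    ‖nonlin (truncCoeff ((n : ℝ) + 1) (galerkinSeq ha n s : 𝓗)) (truncCoeff ((n : ℝ) + 1) (galerkinSeq ha n s : 𝓗)) ξ -
        limitNonlin ha A s ξ‖ ≤
      (FujitaKato.nonlinC (Fin 3)).toReal * ρ * (2 * ‖datumLp ha‖) * approxRate ha A n := by
  set f := truncCoeff ((n : ℝ) + 1) (galerkinSeq ha n s : 𝓗) with hf
  set g := limitCoeff ha A s with hg
  have hfm : AEStronglyMeasurable f volume := aestronglyMeasurable_truncCoeff _ _
  have hgm : AEStronglyMeasurable g volume := aestronglyMeasurable_coeff _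
  have hf2 : ∀ j, MemLp (fun η => f η j) 2 volume := memLp_truncCoeff _ _
  have hg2 : ∀ j, MemLp (fun η => g η j) 2 volume := fun j => memLp_coeff _ j
  -- the decomposition `N(f,f) − N(g,g) = N(f−g, f) + N(g, f−g)`
  have hdec : nonlin f f ξ - limitNonlin ha A s ξ = nonlin (f - g) f ξ + nonlin g (f - g) ξ := by
    rw [limitNonlin_apply, ← hg, nonlin_sub_left_of_memLp hf2 hg2 hf2 ξ, nonlin_sub_right_of_memLp hg2 hf2 hg2 ξ]
    abel
  -- norms
  have hδ := lintegral_enorm_truncCoeff_galerkinSeq_sub_limitCoeff_le ha hA hM n hs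
  have hfn : (∫⁻ η, ‖f η‖ₑ ^ 2) ^ (1 / 2 : ℝ) ≤ ENNReal.ofReal ‖datumLp ha‖ :=
    (lintegral_enorm_truncCoeff_sq_rpow_le _ _).trans (ENNReal.ofReal_le_ofReal (norm_galerkinSeq_le ha n hs))
  have hgn : (∫⁻ η, ‖g η‖ₑ ^ 2) ^ (1 / 2 : ℝ) ≤ ENNReal.ofReal ‖datumLp ha‖ :=
    (lintegral_enorm_coeff_sq_rpow_le _).trans (ENNReal.ofReal_le_ofReal (norm_galerkinLimit_le ha hA hM s))
  have hξe : ‖ξ‖ₑ ≤ ENNReal.ofReal ρ := by rw [← ofReal_norm]; exact ENNReal.ofReal_le_ofReal hξ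
  have hC : FujitaKato.nonlinC (Fin 3) = ENNReal.ofReal (FujitaKato.nonlinC (Fin 3)).toReal :=
    (ENNReal.ofReal_toReal FujitaKato.nonlinC_ne_top).symm
  have hδ0 := approxRate_nonneg ha hA n
  have hprod : ∀ x y : ℝ, 0 ≤ x → ENNReal.ofReal ((FujitaKato.nonlinC (Fin 3)).toReal * ρ * (x * y)) =
      FujitaKato.nonlinC (Fin 3) * ENNReal.ofReal ρ * (ENNReal.ofReal x * ENNReal.ofReal y) := fun x y hx => by
    rw [ENNReal.ofReal_mul (by positivity), ENNReal.ofReal_mul ENNReal.toReal_nonneg, ENNReal.ofReal_mul hx, ← hC]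
  have h1 : ‖nonlin (f - g) f ξ‖ₑ ≤ ENNReal.ofReal ((FujitaKato.nonlinC (Fin 3)).toReal * ρ *
      (approxRate ha A n * ‖datumLp ha‖)) := by
    rw [hprod _ _ hδ0]
    exact (enorm_nonlin_le_mul_rpow (hfm.sub hgm) hfm ξ).trans
      (mul_le_mul' (mul_le_mul' le_rfl hξe) (mul_le_mul' hδ hfn))
  have h2 : ‖nonlin g (f - g) ξ‖ₑ ≤ ENNReal.ofReal ((FujitaKato.nonlinC (Fin 3)).toReal * ρ *
      (‖datumLp ha‖ * approxRate ha A n)) := by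
    rw [hprod _ _ (norm_nonneg _)]
    exact (enorm_nonlin_le_mul_rpow hgm (hfm.sub hgm) ξ).trans
      (mul_le_mul' (mul_le_mul' le_rfl hξe) (mul_le_mul' hgn hδ))
  rw [hdec]
  refine (norm_add_le _ _).trans ?_
  rw [← toReal_enorm, ← toReal_enorm]
  have ht1 := ENNReal.toReal_mono ENNReal.ofReal_ne_top h1
  have ht2 := ENNReal.toReal_mono ENNReal.ofReal_ne_top h2
  rw [ENNReal.toReal_ofReal (by positivity)] at ht1 ht2
  nlinarith [ht1, ht2]

end Convergence

/-! ### The weak identity in the limit and the Duhamel representative -/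

section Identification

variable {a : ℝ³ → Fin 3 → ℂ} {A : ℝ}

/-- A bounded set has finite volume. [folklore] -/
theorem volume_ne_top_of_subset_closedBall {S : Set ℝ³} {ρ : ℝ} (hSρ : S ⊆ closedBall (0 : ℝ³) ρ) :
    volume S ≠ ⊤ :=
  ((measure_mono hSρ).trans_lt measure_closedBall_lt_top).ne

/-- The pairing of the Galerkin nonlinearity with a test element supported in the cut-off ball is
the set integral of a component of the nonlinearity of the truncated states. [folklore] -/
theorem inner_testLp_galerkinNonlin {S : Set ℝ³} (hS : MeasurableSet S) {ρ : ℝ}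
    (hSρ : S ⊆ closedBall (0 : ℝ³) ρ) (l : Fin 3) {R : ℝ} (hρR : ρ ≤ R) (v : 𝓗) :
    ⟪testLp hS (volume_ne_top_of_subset_closedBall hSρ) l, galerkinNonlin R v v⟫_ℂ =
      ∫ ξ in S, nonlin (truncCoeff R v) (truncCoeff R v) ξ l := by
  rw [inner_galerkinNonlin, ← integral_sum_mul_conj_coeff_testLp hS (volume_ne_top_of_subset_closedBall hSρ) l]
  refine integral_congr_ae ((truncCoeff_testLp_ae hS (volume_ne_top_of_subset_closedBall hSρ) l hSρ hρR).mono
    fun ξ hξ => ?_)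
  simp only [hξ]

variable (ha : IsSobolevFourierDatum a) (hA : 0 ≤ A)
  (hM : ∫⁻ ξ, ENNReal.ofReal ((1 + ‖ξ‖) ^ 6) * ∑ l, ‖a ξ l‖ₑ ^ 2 ≤ ENNReal.ofReal A)
include hA hM

/-- The Duhamel integral of a component is continuous in the frequency. [folklore] -/
theorem continuous_intervalIntegral_limitNonlin (c : ℝ) (l : Fin 3) :
    Continuous fun ξ : ℝ³ => ∫ s in (0 : ℝ)..c, limitNonlin ha A s ξ l := by
  have h1 := (continuous_limitNonlin ha hA hM l).comp continuous_swap
  have hc : Continuous (uncurry fun (ξ : ℝ³) (s : ℝ) => limitNonlin ha A s ξ l) := h1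
  exact intervalIntegral.continuous_parametric_intervalIntegral_of_continuous' hc 0 c

omit hA hM in
/-- The pairing of the `n`-th Galerkin nonlinearity with `φ` at time `s`. [folklore] -/
def galerkinPairing (φ : 𝓗) (n : ℕ) (s : ℝ) : ℂ :=
  ⟪φ, galerkinNonlin ((n : ℝ) + 1) (galerkinSeq ha n s : 𝓗) (galerkinSeq ha n s : 𝓗)⟫_ℂ

omit hA hM in
/-- The set integral of a component of the nonlinearity along the limit. [folklore] -/
def limitPairing (A : ℝ) (S : Set ℝ³) (l : Fin 3) (s : ℝ) : ℂ := ∫ ξ in S, limitNonlin ha A s ξ l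

/-- **The weak identity in the limit**: for a bounded measurable frequency set `S`, a component
`l` and `0 ≤ t ≤ τ(A)`,
`∫_S Ṽ(t)_l = ∫_S a_l − ∫₀ᵗ ∫_S N(Ṽ(s),Ṽ(s))_l dξ ds`
(the weak form of the Galerkin equations passes to the limit: MB's (3.64)–(3.65) argument,
pp. 109–110, on the Fourier side). [cite: MajdaBertozzi2002, Thm. 3.4 proof pp. 109-110] -/
theorem setIntegral_limitCoeff_eq {t : ℝ} (ht : t ∈ Icc 0 (lifespan A)) {S : Set ℝ³} (hS : MeasurableSet S)
    {ρ : ℝ} (hρ : 0 ≤ ρ) (hSρ : S ⊆ closedBall (0 : ℝ³) ρ) (l : Fin 3) :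
    ∫ ξ in S, limitCoeff ha A t ξ l = (∫ ξ in S, a ξ l) -
      ∫ s in (0 : ℝ)..t, ∫ ξ in S, limitNonlin ha A s ξ l := by
  have hμ := volume_ne_top_of_subset_closedBall hSρ
  have hμlt : volume S < ⊤ := lt_top_iff_ne_top.2 hμ
  have hW : ∀ n, ⟪testLp hS hμ l, (galerkinSeq ha n t : 𝓗)⟫_ℂ = ⟪testLp hS hμ l, datumLp ha⟫_ℂ -
      ∫ s in (0 : ℝ)..t, galerkinPairing ha (testLp hS hμ l) n s :=
    fun n => inner_galerkinSeq_eq ha (testLp hS hμ l) n ht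
  -- left-hand sides converge
  have hL : Tendsto (fun n => ⟪testLp hS hμ l, (galerkinSeq ha n t : 𝓗)⟫_ℂ) atTop
      (𝓝 (∫ ξ in S, limitCoeff ha A t ξ l)) := by
    have h1 := tendsto_galerkinSeq ha hA hM t
    rw [clamp_of_mem ht] at h1
    have h2 := ((innerSL ℂ (testLp hS hμ l)).continuous.tendsto _).comp h1
    simp only [Function.comp_def, innerSL_apply_apply] at h2
    rwa [inner_testLp] at h2
  -- eventually the pairings are set integrals
  obtain ⟨N₀, hN₀⟩ := exists_nat_ge ρ
  have hQ' : ∀ n, N₀ ≤ n → ∀ s, galerkinPairing ha (testLp hS hμ l) n s =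
      ∫ ξ in S, nonlin (truncCoeff ((n : ℝ) + 1) (galerkinSeq ha n s : 𝓗))
      (truncCoeff ((n : ℝ) + 1) (galerkinSeq ha n s : 𝓗)) ξ l := fun n hn s => by
    have hρn : ρ ≤ (n : ℝ) + 1 := hN₀.trans (by exact_mod_cast Nat.le_succ_of_le hn)
    exact inner_testLp_galerkinNonlin hS hSρ l hρn _
  -- bounds
  obtain ⟨C₀, hC₀0, hC₀⟩ := exists_norm_limitNonlin_le ha hA hM 0
  have hPb : ∀ s, ‖limitPairing ha A S l s‖ ≤ C₀ * (volume S).toReal := fun s => by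
    refine (norm_setIntegral_le_of_norm_le_const hμlt fun ξ _ => ?_)
    calc ‖limitNonlin ha A s ξ l‖ ≤ ‖limitNonlin ha A s ξ‖ := norm_le_pi_norm _ l
      _ ≤ C₀ * ((1 + ‖ξ‖) ^ 0)⁻¹ := hC₀ s ξ
      _ = C₀ := by simp
  have hK0 : 0 ≤ (FujitaKato.nonlinC (Fin 3)).toReal * ρ * (2 * ‖datumLp ha‖) := by positivity
  have hdiff : ∀ n, N₀ ≤ n → ∀ s ∈ Icc 0 (lifespan A), ‖galerkinPairing ha (testLp hS hμ l) n s - limitPairing ha A S l s‖ ≤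
      (FujitaKato.nonlinC (Fin 3)).toReal * ρ * (2 * ‖datumLp ha‖) * approxRate ha A n * (volume S).toReal :=
    fun n hn s hs => by
    rw [hQ' n hn s, limitPairing]
    rw [← integral_sub]
    · refine norm_setIntegral_le_of_norm_le_const hμlt fun ξ hξ => ?_
      have hξρ : ‖ξ‖ ≤ ρ := mem_closedBall_zero_iff.1 (hSρ hξ)
      calc ‖nonlin _ _ ξ l - limitNonlin ha A s ξ l‖ = ‖(nonlin (truncCoeff ((n : ℝ) + 1) (galerkinSeq ha n s : 𝓗))
            (truncCoeff ((n : ℝ) + 1) (galerkinSeq ha n s : 𝓗)) ξ - limitNonlin ha A s ξ) l‖ := rfl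
        _ ≤ ‖nonlin (truncCoeff ((n : ℝ) + 1) (galerkinSeq ha n s : 𝓗))
            (truncCoeff ((n : ℝ) + 1) (galerkinSeq ha n s : 𝓗)) ξ - limitNonlin ha A s ξ‖ := norm_le_pi_norm _ l
        _ ≤ _ := norm_nonlin_galerkinSeq_sub_limitNonlin_le ha hA hM n hs hρ hξρ
    · have hc := (continuous_nonlin_truncCoeff ((n : ℝ) + 1) (galerkinSeq ha n s : 𝓗) (galerkinSeq ha n s : 𝓗) l)
      exact (hc.continuousOn.integrableOn_compact (isCompact_closedBall (0 : ℝ³) ρ)).mono_set hSρ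
    · exact ((continuous_limitNonlin_right_apply ha hA hM s l).continuousOn.integrableOn_compact
        (isCompact_closedBall (0 : ℝ³) ρ)).mono_set hSρ
  -- dominated convergence for the time integrals
  have hR : Tendsto (fun n => ∫ s in (0 : ℝ)..t, galerkinPairing ha (testLp hS hμ l) n s) atTop
      (𝓝 (∫ s in (0 : ℝ)..t, limitPairing ha A S l s)) := by
    have hIoc : uIoc 0 t ⊆ Icc 0 (lifespan A) := by
      rw [uIoc_of_le ht.1]; exact Ioc_subset_Icc_self.trans (Icc_subset_Icc_right ht.2)
    refine intervalIntegral.tendsto_integral_filter_of_dominated_convergence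
      (fun _ => C₀ * (volume S).toReal + (FujitaKato.nonlinC (Fin 3)).toReal * ρ * (2 * ‖datumLp ha‖) *
        approxRate ha A 0 * (volume S).toReal) ?_ ?_ ?_ ?_
    · refine Eventually.of_forall fun n => ?_
      have hcα : ContinuousOn (fun s => (galerkinSeq ha n s : 𝓗)) (Icc 0 (lifespan A)) := fun s hs =>
        (hasDerivWithinAt_coe_of_galerkinField (galerkinSeq_hasDerivWithinAt ha n (lifespan A) s hs)).continuousWithinAt
      have hc : ContinuousOn (galerkinPairing ha (testLp hS hμ l) n) (Icc 0 (lifespan A)) :=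
        continuousOn_const.inner ((continuous_galerkinNonlin_self _).comp_continuousOn hcα)
      exact (hc.mono hIoc).aestronglyMeasurable measurableSet_uIoc
    · refine eventually_atTop.2 ⟨N₀, fun n hn => Eventually.of_forall fun s hs => ?_⟩
      have h1 := hdiff n hn s (hIoc hs)
      have h2 : approxRate ha A n ≤ approxRate ha A 0 := by
        unfold approxRate
        refine div_le_div_of_nonneg_left (by have := cauchyConst_nonneg hA; positivity) (by norm_num) ?_
        have : (0 : ℝ) ≤ n := n.cast_nonneg
        push_cast; linarith
      calc ‖galerkinPairing ha (testLp hS hμ l) n s‖ = ‖limitPairing ha A S l s +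
            (galerkinPairing ha (testLp hS hμ l) n s - limitPairing ha A S l s)‖ := by rw [add_sub_cancel]
        _ ≤ ‖limitPairing ha A S l s‖ + ‖galerkinPairing ha (testLp hS hμ l) n s - limitPairing ha A S l s‖ :=
            norm_add_le _ _
        _ ≤ C₀ * (volume S).toReal + (FujitaKato.nonlinC (Fin 3)).toReal * ρ * (2 * ‖datumLp ha‖) *
            approxRate ha A n * (volume S).toReal := add_le_add (hPb s) h1
        _ ≤ _ := by gcongr
    · exact intervalIntegrable_const
    · refine Eventually.of_forall fun s hs => ?_
      rw [tendsto_iff_norm_sub_tendsto_zero]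
      have hlim : Tendsto (fun n => (FujitaKato.nonlinC (Fin 3)).toReal * ρ * (2 * ‖datumLp ha‖) *
          approxRate ha A n * (volume S).toReal) atTop (𝓝 0) := by
        have := ((tendsto_approxRate (A := A) ha).const_mul ((FujitaKato.nonlinC (Fin 3)).toReal * ρ *
          (2 * ‖datumLp ha‖))).mul_const (volume S).toReal
        simpa using this
      refine tendsto_of_tendsto_of_tendsto_of_le_of_le' tendsto_const_nhds hlim
        (Eventually.of_forall fun n => norm_nonneg _) (eventually_atTop.2 ⟨N₀, fun n hn => hdiff n hn s (hIoc hs)⟩)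
  -- conclude
  have hR' : Tendsto (fun n => ⟪testLp hS hμ l, datumLp ha⟫_ℂ -
      ∫ s in (0 : ℝ)..t, galerkinPairing ha (testLp hS hμ l) n s) atTop
      (𝓝 (⟪testLp hS hμ l, datumLp ha⟫_ℂ - ∫ s in (0 : ℝ)..t, limitPairing ha A S l s)) :=
    tendsto_const_nhds.sub hR
  have heq := tendsto_nhds_unique hL (hR'.congr fun n => (hW n).symm)
  rw [heq, inner_testLp]
  congr 1
  refine setIntegral_congr_ae hS ((coeff_datumLp_ae ha).mono fun ξ hξ _ => hξ l)

/-- **The Duhamel representative of the limit**: the everywhere-defined field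
`v(t, ξ) = a(ξ) − ∫₀^{clamp τ t} N(Ṽ(s), Ṽ(s))(ξ) ds` (the inviscid Duhamel = integrated form).
[cite: MajdaBertozzi2002, Thm. 3.4 proof, (3.65) p. 110] -/
def eulerMild (ha : IsSobolevFourierDatum a) (A : ℝ) (t : ℝ) (ξ : ℝ³) : Fin 3 → ℂ :=
  a ξ - ∫ s in (0 : ℝ)..clamp (lifespan A) t, limitNonlin ha A s ξ

/-- Components of the Duhamel representative. [folklore] -/
theorem eulerMild_apply (t : ℝ) (ξ : ℝ³) (l : Fin 3) :
    eulerMild ha A t ξ l = a ξ l - ∫ s in (0 : ℝ)..clamp (lifespan A) t, limitNonlin ha A s ξ l := by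
  rw [eulerMild, Pi.sub_apply]
  congr 1
  have hint : IntervalIntegrable (fun s => limitNonlin ha A s ξ) volume 0 (clamp (lifespan A) t) :=
    (continuous_limitNonlin_left ha hA hM ξ).intervalIntegrable _ _
  have h := (ContinuousLinearMap.proj (R := ℝ) (φ := fun _ : Fin 3 => ℂ) l).intervalIntegral_comp_comm hint
  simp only [ContinuousLinearMap.proj_apply] at h
  exact h.symm

/-- **Fubini for the Duhamel integral over a bounded frequency set.** [folklore] -/
theorem setIntegral_intervalIntegral_limitNonlin {S : Set ℝ³} {ρ : ℝ}
    (hSρ : S ⊆ closedBall (0 : ℝ³) ρ) (l : Fin 3) (c : ℝ) :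
    ∫ ξ in S, (∫ s in (0 : ℝ)..c, limitNonlin ha A s ξ l) = ∫ s in (0 : ℝ)..c, ∫ ξ in S, limitNonlin ha A s ξ l := by
  symm
  refine intervalIntegral_integral_swap (μ := volume.restrict S) (f := fun s ξ => limitNonlin ha A s ξ l) ?_
  rw [Measure.prod_restrict]
  have h1 := continuous_limitNonlin ha hA hM l
  have hc : Continuous (uncurry fun s ξ => limitNonlin ha A s ξ l) := h1
  refine ((hc.continuousOn.integrableOn_compact ((isCompact_uIcc (a := 0) (b := c)).prod
    (isCompact_closedBall (0 : ℝ³) ρ))).mono_set (Set.prod_mono uIoc_subset_uIcc hSρ))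

/-- **The Duhamel representative equals the limit field a.e., at every time of the lifespan**
(test against indicators of bounded sets, Fubini, and the weak identity in the limit).
[cite: MajdaBertozzi2002, Thm. 3.4 proof pp. 109-110] -/
theorem eulerMild_ae_eq {t : ℝ} (ht : t ∈ Icc 0 (lifespan A)) :
    ∀ᵐ ξ ∂(volume : Measure ℝ³), eulerMild ha A t ξ = limitCoeff ha A t ξ := by
  have hct : clamp (lifespan A) t = t := clamp_of_mem ht
  suffices h : ∀ l, ∀ᵐ ξ ∂(volume : Measure ℝ³), eulerMild ha A t ξ l = limitCoeff ha A t ξ l by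
    have h' := ae_all_iff.2 h
    exact h'.mono fun ξ hξ => funext hξ
  intro l
  -- work on the balls of integer radius
  have hball : ∀ ρ : ℕ, ∀ᵐ ξ ∂(volume.restrict (closedBall (0 : ℝ³) ρ)),
      eulerMild ha A t ξ l - limitCoeff ha A t ξ l = 0 := by
    intro ρ
    have hfin : IsFiniteMeasure (volume.restrict (closedBall (0 : ℝ³) (ρ : ℝ))) :=
      isFiniteMeasure_restrict.2 measure_closedBall_lt_top.ne
    -- integrability on the ball
    have hEa : IntegrableOn (fun ξ => a ξ l) (closedBall (0 : ℝ³) (ρ : ℝ)) volume := by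
      have hm : MemLp (fun ξ => a ξ l) 2 (volume.restrict (closedBall (0 : ℝ³) (ρ : ℝ))) := by
        have h0 := (memLp_coeff (datumLp ha) l).ae_eq ((coeff_datumLp_ae ha).mono fun ξ hξ => hξ l)
        exact h0.restrict _
      exact hm.integrable one_le_two
    have hED : IntegrableOn (fun ξ => ∫ s in (0 : ℝ)..t, limitNonlin ha A s ξ l) (closedBall (0 : ℝ³) (ρ : ℝ)) volume :=
      (continuous_intervalIntegral_limitNonlin ha hA hM t l).continuousOn.integrableOn_compact (isCompact_closedBall _ _)
    have hEV : IntegrableOn (fun ξ => limitCoeff ha A t ξ l) (closedBall (0 : ℝ³) (ρ : ℝ)) volume :=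
      ((memLp_coeff _ l).restrict _).integrable one_le_two
    have hE : ∀ ξ, eulerMild ha A t ξ l = a ξ l - ∫ s in (0 : ℝ)..t, limitNonlin ha A s ξ l := fun ξ => by
      rw [eulerMild_apply ha hA hM, hct]
    have hI : IntegrableOn (fun ξ => eulerMild ha A t ξ l - limitCoeff ha A t ξ l) (closedBall (0 : ℝ³) (ρ : ℝ))
        volume := by
      simp_rw [hE]
      exact (hEa.sub hED).sub hEV
    refine ae_eq_zero_of_forall_setIntegral_eq_of_sigmaFinite (fun s hs _ => hI.integrable.integrableOn)
      fun s hs _ => ?_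
    rw [Measure.restrict_restrict hs]
    have hS' : MeasurableSet (s ∩ closedBall (0 : ℝ³) ρ) := hs.inter measurableSet_closedBall
    have hSρ : s ∩ closedBall (0 : ℝ³) ρ ⊆ closedBall (0 : ℝ³) ρ := inter_subset_right
    have hW := setIntegral_limitCoeff_eq ha hA hM ht hS' (Nat.cast_nonneg ρ) hSρ l
    have hF := setIntegral_intervalIntegral_limitNonlin ha hA hM hSρ l t
    simp_rw [hE]
    rw [integral_sub ((hEa.mono_set hSρ).sub' (hED.mono_set hSρ)) (hEV.mono_set hSρ),
      integral_sub (hEa.mono_set hSρ) (hED.mono_set hSρ), hW, hF]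
    ring
  -- glue the balls
  have huniv : (⋃ ρ : ℕ, closedBall (0 : ℝ³) (ρ : ℝ)) = univ :=
    eq_univ_of_forall fun ξ => mem_iUnion.2 ⟨⌈‖ξ‖⌉₊, mem_closedBall_zero_iff.2 (Nat.le_ceil _)⟩
  have h := (ae_restrict_iUnion_iff (μ := (volume : Measure ℝ³)) (fun ρ : ℕ => closedBall (0 : ℝ³) (ρ : ℝ))
    (p := fun ξ => eulerMild ha A t ξ l - limitCoeff ha A t ξ l = 0)).2 hball
  rw [huniv, Measure.restrict_univ] at h
  exact h.mono fun ξ hξ => sub_eq_zero.1 hξ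

end Identification

/-! ### The Duhamel representative is a Sobolev-mild solution of the Euler equations -/

section Mild

variable {a : ℝ³ → Fin 3 → ℂ} {A : ℝ}

/-- The inviscid heat factor is `1`. [folklore] -/
theorem heat_zero_left (ξ : ℝ³) (r : ℝ) : heat 0 ξ r = 1 := by simp [heat]

variable (ha : IsSobolevFourierDatum a) (hA : 0 ≤ A)
  (hM : ∫⁻ ξ, ENNReal.ofReal ((1 + ‖ξ‖) ^ 6) * ∑ l, ‖a ξ l‖ₑ ^ 2 ≤ ENNReal.ofReal A)
include hA hM

/-- Joint continuity of the (vector) nonlinearity along the limit, frequency first. [folklore] -/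
theorem continuous_uncurry_limitNonlin :
    Continuous (uncurry fun (ξ : ℝ³) (s : ℝ) => limitNonlin ha A s ξ) := by
  refine continuous_pi fun l => ?_
  have h1 := (continuous_limitNonlin ha hA hM l).comp continuous_swap
  have h2 : Continuous fun p : ℝ³ × ℝ => limitNonlin ha A p.2 p.1 l := h1
  exact h2

/-- The vector Duhamel integral is continuous in the frequency. [folklore] -/
theorem continuous_intervalIntegral_limitNonlin_vec (c : ℝ) :
    Continuous fun ξ : ℝ³ => ∫ s in (0 : ℝ)..c, limitNonlin ha A s ξ :=
  intervalIntegral.continuous_parametric_intervalIntegral_of_continuous' (continuous_uncurry_limitNonlin ha hA hM) 0 c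

/-- **The Duhamel representative of the inviscid Galerkin limit is a Fourier-side Sobolev-mild
solution of the Euler equations on the lifespan** `[0, τ(A)]` (`IsSobolevMild 0 (lifespan A) a v`):
measurable slices, continuity in time, the fixed-point identity (through the a.e. identification
with the limit field and `nonlin_congr_ae`), decay of every order of the Duhamel part (uniform
moments of the limit), the divergence-free relation and the conjugation symmetry. This is the
Fourier-side form of Majda–Bertozzi's Thm. 3.4 for `ν = 0` with the `H³`-controlled lifespan of
Thm. 3.6 ((3.79)). [cite: MajdaBertozzi2002, Thm. 3.4 + (3.79) pp. 104, 116-117] -/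
theorem isSobolevMild_eulerMild : IsSobolevMild 0 (lifespan A) a (eulerMild ha A) where
  meas t := by
    have h : eulerMild ha A t = fun ξ => a ξ - ∫ s in (0 : ℝ)..clamp (lifespan A) t, limitNonlin ha A s ξ := rfl
    rw [h]
    exact ha.meas.sub (continuous_intervalIntegral_limitNonlin_vec ha hA hM _).aestronglyMeasurable
  cont ξ := by
    have h1 : Continuous fun b => ∫ s in (0 : ℝ)..b, limitNonlin ha A s ξ :=
      intervalIntegral.continuous_primitive (fun a b => (continuous_limitNonlin_left ha hA hM ξ).intervalIntegrable a b) 0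
    have h2 := h1.comp (continuous_clamp (lifespan A))
    exact continuous_const.sub h2
  fixed t ξ := by
    have hτ := (lifespan_pos hA).le
    simp only [duhamel, heat_zero_left, one_smul]
    rw [eulerMild]
    congr 1
    refine intervalIntegral.integral_congr fun s hs => ?_
    rw [uIcc_of_le (clamp_nonneg _ _)] at hs
    have hsI : s ∈ Icc 0 (lifespan A) := ⟨hs.1, hs.2.trans (clamp_le hτ _)⟩
    have hae := eulerMild_ae_eq ha hA hM hsI
    rw [limitNonlin_apply]
    exact congr_fun (nonlin_congr_ae hae hae).symm ξ
  decay K := by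
    obtain ⟨C, hC0, hC⟩ := exists_norm_limitNonlin_le ha hA hM K
    refine ⟨C * lifespan A, fun t ξ => ?_⟩
    have hτ := (lifespan_pos hA).le
    have hw : 0 < (1 + ‖ξ‖) ^ K := by positivity
    have h1 : eulerMild ha A t ξ - heat 0 ξ (clamp (lifespan A) t) • a ξ =
        -∫ s in (0 : ℝ)..clamp (lifespan A) t, limitNonlin ha A s ξ := by
      rw [heat_zero_left, one_smul, eulerMild]; abel
    rw [h1, norm_neg]
    have h2 := intervalIntegral.norm_integral_le_of_norm_le_const (a := 0) (b := clamp (lifespan A) t)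
      (f := fun s => limitNonlin ha A s ξ) (C := C * ((1 + ‖ξ‖) ^ K)⁻¹) fun s _ => hC s ξ
    rw [sub_zero, abs_of_nonneg (clamp_nonneg _ _)] at h2
    calc (1 + ‖ξ‖) ^ K * ‖∫ s in (0 : ℝ)..clamp (lifespan A) t, limitNonlin ha A s ξ‖
        ≤ (1 + ‖ξ‖) ^ K * (C * ((1 + ‖ξ‖) ^ K)⁻¹ * clamp (lifespan A) t) := by gcongr
      _ = C * clamp (lifespan A) t := by field_simp
      _ ≤ C * lifespan A := by gcongr; exact clamp_le hτ _
  divFree t ξ := by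
    have hint : ∀ l, IntervalIntegrable (fun s => limitNonlin ha A s ξ l) volume 0 (clamp (lifespan A) t) :=
      fun l => (continuous_limitNonlin_left_apply ha hA hM ξ l).intervalIntegrable _ _
    simp_rw [eulerMild_apply ha hA hM, mul_sub, Finset.sum_sub_distrib, ha.divFree ξ, zero_sub, neg_eq_zero,
      ← intervalIntegral.integral_const_mul]
    rw [← intervalIntegral.integral_finsetSum (fun l _ => (hint l).const_mul _)]
    simp only [limitNonlin_apply, sum_mul_nonlin, intervalIntegral.integral_zero]
  conjSymm t ξ l := by
    rw [eulerMild_apply ha hA hM, eulerMild_apply ha hA hM, ha.conjSymm ξ l, map_sub]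
    congr 1
    have h1 : ∀ s, limitNonlin ha A s (-ξ) l = conj (limitNonlin ha A s ξ l) := fun s =>
      FujitaKato.nonlin_conj_symm_ae (limitCoeff_divFree_conjSymm ha hA hM s).2
        (limitCoeff_divFree_conjSymm ha hA hM s).2 ξ l
    simp_rw [h1]
    simp only [intervalIntegral, integral_conj, map_sub]

omit hA hM in
/-- **Local existence of Fourier-side Sobolev-mild solutions of the Euler equations on `ℝ³` with
`H³`-controlled lifespan**: for a Sobolev Fourier datum `a` with
`∫⁻ (1+‖ξ‖)^6 ∑_l |a_l(ξ)|² ≤ A` there is a mild solution on `[0, τ(A)]`, `τ(A) = lifespan A > 0`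
depending on `A` only. [cite: MajdaBertozzi2002, Thm. 3.4 + Thm. 3.6 (3.79) pp. 104, 116-117] -/
theorem exists_isSobolevMild_euler (ha : IsSobolevFourierDatum a) (hA : 0 ≤ A)
    (hM : ∫⁻ ξ, ENNReal.ofReal ((1 + ‖ξ‖) ^ 6) * ∑ l, ‖a ξ l‖ₑ ^ 2 ≤ ENNReal.ofReal A) :
    ∃ v : ℝ → ℝ³ → Fin 3 → ℂ, IsSobolevMild 0 (lifespan A) a v :=
  ⟨eulerMild ha A, isSobolevMild_eulerMild ha hA hM⟩

end Mild

end Literature.Analysis.FluidPDE.FourierNS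

end
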